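import Literature.MathematicalPhysics.QuantumFieldTheory.Balaban1983to89.B6DomainChangeP2134
import Literature.MathematicalPhysics.QuantumFieldTheory.Balaban1983to89.B6MajorantTransferSteps

/-!
# `Balaban1983to89.B6DomainChangeP2134Sizes` — T. Bałaban, *Propagators and renormalization transformations for lattice gauge theories. II*,
# Commun. Math. Phys. **96** (1984) 223–250 [Balaban1984PropagatorsII], p. 239 (2.92) line 3 `ζ_□(∂P∂* − ∂P_□∂*)h_□`, p. 238 *"an estimate has the factor
# e^{−δ₀M} because of the usual estimate of the type (1.12) [3] connected with a change of a domain"*, p. 247 (2.134): THE BLOCK-MAJORANT SIZES OF THE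
# CHANGE OF DOMAIN FOR THE PROJECTION `P = G′Q′*(Q′G′²Q′*)⁻¹Q′G′` — from the (2.67)/(2.87)-shape majorants of the factors, the zone kernels of the cutoff
# commutator and the depth `≥ M₀` of `supp ζ_□`, `supp h_□` below the zone, to the displayed hypothesis `hD` of the (2.134) diagonal theorems:
# `|ζ_□(∂P∂* − ∂P_□∂*)h_□| ≤ C_D(L^jη)^{−2}e^{−c_DM₀}e^{−rd(y,y′)}` (the second half of B6-CLOSURE item 7 bite (d4))

statement-level skeleton of published theorems with citation tags; proofs where landed; nothing here is a claim about the Yang–Mills mass gap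

PDF held: `paper:balaban1984-cmp96-propagators-rt-ii` (journal page = PDF page + 222); p. 225 [PDF 3] ((2.17)), p. 235 [PDF 13] ((2.67)), p. 238 [PDF 16] ((2.87),
the change-of-domain sentence), p. 239 [PDF 17] ((2.90)–(2.92)), p. 247 [PDF 25] ((2.134)) — read from the tree transcriptions of `…B6DomainMajorant` (b06),
`…B6DomainChangeP2134` (p38 g25/g27), `…B6Eq291Generator` (p02), `…B6Ineq2134Diag` (r03).  PRINT p. 239: *"(K_{□,□}A)_μ(x) = … + (ζ_□(∂P∂* − ∂P_□∂*)h_□A)_μ(x)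
+ … (2.92)"*; p. 238: *"the operator with G′(□̃)² − G′² is small and an estimate has the factor e^{−δ₀M} because of the usual estimate of the type (1.12) [3]
connected with a change of a domain. This estimate follows from the random walk representations (2.50) for the operators G′, G′(□̃). … An estimate of
the terms with the commutator is even simpler and gives a factor O(M⁻¹)."*; p. 235 (2.67) *"|(G′λ)(x)|, |(∇G′λ)(x)|, |(G′∇*λ)(x)|, |(∇G′∇*λ)(x)| ≤
B₁[(L^jη)², L^jη, L^jη, 1]e^{−δ₂d(y,y′)}|λ|"*; p. 238 (2.87) *"|(Q′G′²Q′*)⁻¹(y, y′)| ≤ C(L^jη)^{−4}…e^{−δ₁d(y,y′)}"*.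

CITATION HEADER (lean-in-tree rule) — WHAT IS REPRODUCED.  Phase-2 file of the `lit-balaban` typed skeleton (HOME `run/shared/lean/pub/lit-balaban/`), seat
**p38 gen 27**; owner-named bite **(d4), second half** of B6-CLOSURE §5 item 7 (GAPS **G-B6-p38-02** ADDENDUM 1: *"WHAT REMAINS … the block-majorant SIZES of
the six summands — weights (L^jη)^{±2} of G′/C, the (2.60) scale transfer, the depth ≥ M of the cuts below the zone ⇒ the factor e^{−c_DM}"*); SKELETON rows
**B6.Eq2.91** ((2.92) line 3) × **B6.Eq2.134** × **B6.Eq2.17** (cells only; decls of record untouched; referee ref-4).  CONSUMER: the displayed hypothesis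
`hD₃`/`hD` of `…B6Ineq2134Diag.diag_hasMajorant`, `…B6Ineq2134DiagKLevel(Torus).ineq2134_kDiag_*`, `…B6Ineq2134KFamKLevel(Torus).h2134_kFam_*`
(`HasMajorant blk (mulOp (ζ c) * (Dg − Pl c) * mulOp (h c)) (C_De^{−c_DM}/len(y)²·e^{−δd})` with `Dg − Pl c = ∂∘(P − P_□)∘∂*`), in the (d5-b) assembly
of the genuine k-level Proposition 2.6 (r03).  SIBLINGS BY NAME: `…B6DomainChangeP2134.domainChangeP_expand7_left` (v1.1: the LEFT-ZONE seven-term algebra,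
sandwich form `S = Q′*CQ′`), `…B6MajorantTransferSteps` (the weighted two-space composition with (2.60) transfer and the closed-form steps).

## THE THEOREM (`line3P_hasMajorant`; corollary `line3P_hasMajorant_zone` with the depth = distance to the zone)

DATA on the fine lattices `X_s` (sites, block map `blkS`) and `Y` (bonds, `blkY`) over `𝔅 = g.Site`, block weight `w > 0` (`= L^jη`): site operators `G` (`G′`
global, `G·Δ′ = Δ′·G = 1`), `Gw` (`G′_□`, the transplanted member: `χΔ′G′_□ = χ`), `S = Q′*CQ′`, `Sw = Q′*C_□Q′` (sandwich hypotheses `hS1`, `hS2` of the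
sibling), the cutoff `χ : X_s → [0, 1]` equal to `1` on the blocks outside the ZONE `N ⊂ 𝔅`, a site cut `c_L` inside the core (`c_Lχ = c_L`) absorbed by the
left leg (`ζ∂·c_L = ζ∂`), the legs `EL₀ = ∂ : (X_s → ℝ) → (Y → ℝ)`, `ER₀ = ∂* : (Y → ℝ) → (X_s → ℝ)`, bond cut-offs `ζ`, `h` (`|·| ≤ 1`) living on blocks of
depth `≥ M₀` (`β ≥ M₀`, `β` a depth vanishing on `N`).  DISPLAYED ANALYTIC INPUTS (rate `δ`, transfer `e^{−κd}w(y″) ≤ Λw(y)` with `6κ ≤ δ`, profile `K ≤ K_x`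
on `[δ/192, ∞)`): (2.67)₁ `B₁w²e^{−δd}` for `G`, `Gw`; (2.87)-type `B_Sw^{−4}e^{−δd}` for `S`, `Sw`; (2.67)₂ `C₁we^{−δd}` for `∂G′`, `∂G′_□` (`EL₀ ∘ G`,
`EL₀ ∘ Gw`); (2.67)₃ `C₁we^{−δd}` for `G′∂*`, `G′_□∂*` (`G ∘ ER₀`, `Gw ∘ ER₀`); the ZONE kernels `1_N(y)θe^{−δd}` of `[χ,Δ′]G′`, `[χ,Δ′]G′_□` (b06's `hKG`,
`hKGw` verbatim) and `1_N(y)θ₁w^{−1}e^{−δd}` of `[χ,Δ′]G′∂*`, `[χ,Δ′]G′_□∂*`.  CONCLUSION: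
`HasMajorant blkY (mulOp ζ * ((EL₀ ∘ (GSG − G_wS_wG_w)) ∘ ER₀) * mulOp h) (C_D·e^{−(δ/96)M₀}/w(y)²·e^{−(δ/192)d(y,y′)})`, `C_D = CDtot Λ B₁ B_S C₁ θ θ₁ K_x` an
explicit polynomial, linear in the zone sizes `θ`, `θ₁` up to the three `(1 − χ)`-terms (whose smallness is the depth factor alone, as b06's term `G(1 − χ²)G`).
MECHANISM: `domainChangeP_expand7_left` ⇒ seven chains `∂G′·[χ,Δ′](G′_□ − G′)·S·G′∂*`, `∂G′_□·S_□·G′_□·G′[χ,Δ′](G′ − G′_□)·S·G′∂*`, … built right-to-left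
with `step_exp_exp` / `step_zone_exp` / `step_exp_zone` / `step_exp_shape` (each summand meets the zone ONCE ⇒ one (1.12)-shape with the depth of both ends),
summed, and evaluated at depth `M₀` (`deep_eval_shape`).
No hypothesis-shaped fact; one real-valued `def` (`CDtot`); standard axioms.
HONEST SCOPE / DIVERGENCES. (1) INPUTS DISPLAYED, not certified here: the factor majorants ((2.67) for the genuine k-level `G′` = p21's files; the member and
its transplant = p22/r03), the zone kernels (locality of `Δ′_a` + (2.67)₂₋₄ + the slope of `χ` — as b06's `hKG`), the ring data (`hS1`, `hS2`, `χΔ′G′_□ = χ`,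
the left-leg absorption), (2.54)/(2.60)/(2.61) as `IsPseudoDist`/transfer/`Profile`.  (2) RATES: print has *"the factor e^{−δ₀M}"* at full rate; the
certificate has `e^{−(δ/96)M₀}` and decay `e^{−(δ/192)d}` (seven compositions, halving/thirding — cell DIVERGENCE D-b06.21); `θ = O(M⁻¹)` is not used (the
depth factor alone makes line 3 small).  (3) `χ ∈ [0, 1]` (so `|1 − χ| ≤ 1`); sharp or smooth is the consumer's choice (it only changes `θ`, `θ₁`).  (4) Route
OURS (resolvent/commutator identities, b06's declared route), not print's walk-by-walk subtraction of (2.50).  Nothing on d = 4 or the continuum; NOT summit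
progress.  Unit `lit-balaban-p38` (gen 27), 2026-08-23.

v1.1 (p38 gen 27, p22 gen 20's flag of 2026-08-23T05:54Z): **THE CUT LEGS**.  For a transplanted member `G_w = εG′_□ρ` the uncut legs `∂∘G_w`, `G_w∘∂*`
have NO uniform (2.67)₂,₃ majorant at the bonds crossing the window boundary (the extension by zero jumps), while in all seven summands of `line3P_expand` the
left leg is followed by `ζ·` and the right leg preceded by `·h`; §4 restates the theorem with the six leg inputs CUT — `ζ∂∘G`, `ζ∂∘G_w`, `G∘∂*h`, `G_w∘∂*h`,
`[χ,Δ′]G∂*h`, `[χ,Δ′]G_w∂*h` (`line3P_hasMajorant_cut`, `line3P_hasMajorant_zone_cut`) — as a COROLLARY of `line3P_hasMajorant` (applied to the legs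
`ζ∂`, `∂*h` and the indicator cut-offs `1_{ζ≠0}`, `1_{h≠0}`, then `1_{ζ≠0}ζ = ζ`, `h1_{h≠0} = h`); same conclusion, all other hypotheses unchanged.

v1.2 (p38 gen 27; p22 gen 20's flag 2026-08-23T06:25:36Z — the zone-leg inputs `mKGE`/`mKGwE` would need the mixed kernel `∇G′∇*`): §5 `CDgk`,
`step_colzone_exp` (column-zone ⋆ exp → shape), **`line3P_hasMajorant_gk`** (term 6 re-associated as `(G′[χ,Δ′])·(G′_□∂* − G′∂*)`; displayed input
`mGK` = the column-zone kernel `θ₂·1_N(y′)·e^{−δd}` of `G′[χ,Δ′]` in place of the two zone-leg kernels), `line3P_hasMajorant_gk_cut`, `line3P_hasMajorant_gk_zone_cut`.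
-/

namespace Literature.MathematicalPhysics.QuantumFieldTheory.Balaban1983to89.B6DomainChangeP2134Sizes

open B4Sect5Torus (IsPseudoDist)
open B6DomainChange (IsDepth Profile)
open B6DomainMajorant (expK zoneK expK_apply zoneK_apply expK_nonneg zoneK_nonneg zoneDepth isDepth_zoneDepth zoneDepth_eq_zero le_zoneDepth)
open B6RandomWalk (HasMajorant hasMajorant_mono)
open B6RandomWalkHom (HasMajorantHom hasMajorantHom_iff hasMajorantHom_mono hasMajorantHom_add)
open B6MajorantTransferSteps (shapeK shapeK_apply shapeK_nonneg one_le_transfer step_exp_exp step_zone_exp step_exp_zone step_exp_shape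
  hom_mulOp_right hom_mulOp_left hom_zoneCut_exp hom_sub hom_sub_exp hom_sub_zone hom_weaken_exp hom_weaken_zone hom_weaken_shape deep_eval_shape
  comp_transfer tilt_expK_le)
open B6DomainMajorant (shape_conv_zone)
open B6DomainChangeP2134 (domainChangeP_expand7_left)
open B9Thm37Sum (mulOp mulOp_apply)
open B9Eq395Small (mulOp_mul_mulOp)

variable {g : B6.Geometry}

/-! ## §0  The constant -/

/-- **THE CONSTANT `C_D` OF LINE 3** (closed form, manifestly uniform: a polynomial in the transfer constant `Λ`, the (2.67)₁ constant `B₁`, the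
(2.87)-type constant `B_S`, the leg constant `C₁`, the zone sizes `θ` (commutator) / `θ₁` (commutator on a leg) and the profile bound `K_x` of (2.61)); the
seven monomials are the seven summands of `domainChangeP_expand7_left` in order — `θ`-terms 1, 2, 4, `θ₁`-term 6, and the `(1 − χ)`-terms 3, 5, 7.
OURS (typing). [cite: Balaban1984PropagatorsII, p.238 («an estimate has the factor e^{−δ₀M}»), (2.92) p.239 (line 3)] -/
noncomputable def CDtot (Λ B₁ BS C₁ θ θ₁ Kx : ℝ) : ℝ :=
  2 * Λ ^ 7 * θ * BS * C₁ ^ 2 * Kx ^ 3 + 2 * Λ ^ 12 * θ * B₁ ^ 2 * BS ^ 2 * C₁ ^ 2 * Kx ^ 6 +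
    2 * Λ ^ 9 * B₁ ^ 2 * BS ^ 2 * C₁ ^ 2 * Kx ^ 5 + 2 * Λ ^ 10 * θ * B₁ ^ 2 * BS ^ 2 * C₁ ^ 2 * Kx ^ 6 +
    2 * Λ ^ 9 * B₁ ^ 2 * BS ^ 2 * C₁ ^ 2 * Kx ^ 5 + 2 * Λ ^ 5 * θ₁ * B₁ * BS * C₁ * Kx ^ 3 + 2 * Λ ^ 4 * BS * C₁ ^ 2 * Kx ^ 2

/-- `C_D ≥ 0` for non-negative constants. [cite: Balaban1984PropagatorsII, p.238] -/
theorem CDtot_nonneg {Λ B₁ BS C₁ θ θ₁ Kx : ℝ} (hΛ : 0 ≤ Λ) (hB₁ : 0 ≤ B₁) (hBS : 0 ≤ BS) (hC₁ : 0 ≤ C₁) (hθ : 0 ≤ θ) (hθ₁ : 0 ≤ θ₁)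
    (hKx : 0 ≤ Kx) : 0 ≤ CDtot Λ B₁ BS C₁ θ θ₁ Kx := by
  unfold CDtot; positivity

/-! ## §1  The step lemmas with explicit targets (wrappers of `…B6MajorantTransferSteps`) -/

section Wrappers

variable [DecidableEq g.Site] {X Y Z : Type}

omit [DecidableEq g.Site] in
/-- `step_exp_exp` with the output exponent, rate and constant named, the profile value bounded by `K_x`. [cite: Balaban1984PropagatorsII, (2.52)–(2.55) p.232, (2.60)–(2.61) p.234] -/
private theorem sEE (blkX : X → g.Site) (blkY : Y → g.Site) (blkZ : Z → g.Site) (hρ : IsPseudoDist g.dist)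
    {K : ℝ → ℝ} (hK : ∀ a, 0 < a → 0 ≤ K a) (hPr : Profile g.dist (fun a : g.Site => a) K)
    {w : g.Site → ℝ} (hw : ∀ a, 0 < w a) {κ Λ : ℝ} (hΛ : 0 ≤ Λ) (hT : ∀ a c, Real.exp (-(κ * g.dist a c)) * w c ≤ Λ * w a)
    {T₁ : (Y → ℝ) →ₗ[ℝ] (Z → ℝ)} {T₂ : (X → ℝ) →ₗ[ℝ] (Y → ℝ)} {γ₁ γ₂ : ℤ} {c₁ δ₁ c₂ r Kx : ℝ} (γ : ℤ) (n : ℕ) (r' c : ℝ)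
    (hγ : γ₁ + γ₂ = γ) (hn : γ₂.natAbs = n) (hr' : r / 2 = r') (hc : Λ ^ n * c₁ * c₂ * Kx = c) (hKr : K r' ≤ Kx)
    (hc₁ : 0 ≤ c₁) (hc₂ : 0 ≤ c₂) (hr : 0 < r) (hrδ : r + n * κ ≤ δ₁)
    (h₁ : HasMajorantHom blkY blkZ T₁ (fun a b => w a ^ γ₁ * expK g c₁ δ₁ a b))
    (h₂ : HasMajorantHom blkX blkY T₂ (fun a b => w a ^ γ₂ * expK g c₂ r a b)) :
    HasMajorantHom blkX blkZ (T₁ ∘ₗ T₂) (fun a b => w a ^ γ * expK g c r' a b) := by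
  subst hγ hr' hn hc
  have hK2 : 0 ≤ K (r / 2) := hK _ (by positivity)
  exact hom_weaken_exp blkX blkZ hρ hw (by positivity) (mul_le_mul_of_nonneg_left hKr (by positivity)) le_rfl
    (step_exp_exp blkX blkY blkZ hρ hPr hw hT hc₁ hc₂ hr hrδ h₁ h₂)

/-- `step_zone_exp` with named outputs and `K ≤ K_x`. [cite: Balaban1984PropagatorsII, (2.52)–(2.55) p.232, (2.60)–(2.61) p.234, p.238] -/
private theorem sZE (blkX : X → g.Site) (blkY : Y → g.Site) (blkZ : Z → g.Site) (hρ : IsPseudoDist g.dist)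
    {K : ℝ → ℝ} (hK : ∀ a, 0 < a → 0 ≤ K a) (hPr : Profile g.dist (fun a : g.Site => a) K) (N : Finset g.Site)
    {w : g.Site → ℝ} (hw : ∀ a, 0 < w a) {κ Λ : ℝ} (hΛ : 0 ≤ Λ) (hT : ∀ a c, Real.exp (-(κ * g.dist a c)) * w c ≤ Λ * w a)
    {T₁ : (Y → ℝ) →ₗ[ℝ] (Z → ℝ)} {T₂ : (X → ℝ) →ₗ[ℝ] (Y → ℝ)} {γ₁ γ₂ : ℤ} {θ δ₁ c₂ r Kx : ℝ} (γ : ℤ) (n : ℕ) (r' c : ℝ)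
    (hγ : γ₁ + γ₂ = γ) (hn : γ₂.natAbs = n) (hr' : r / 2 = r') (hc : Λ ^ n * θ * c₂ * Kx = c) (hKr : K r' ≤ Kx)
    (hθ : 0 ≤ θ) (hc₂ : 0 ≤ c₂) (hr : 0 < r) (hrδ : r + n * κ ≤ δ₁)
    (h₁ : HasMajorantHom blkY blkZ T₁ (fun a b => w a ^ γ₁ * zoneK g N θ δ₁ a b))
    (h₂ : HasMajorantHom blkX blkY T₂ (fun a b => w a ^ γ₂ * expK g c₂ r a b)) :
    HasMajorantHom blkX blkZ (T₁ ∘ₗ T₂) (fun a b => w a ^ γ * zoneK g N c r' a b) := by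
  subst hγ hr' hn hc
  have hK2 : 0 ≤ K (r / 2) := hK _ (by positivity)
  exact hom_weaken_zone blkX blkZ hρ hw N (by positivity) (mul_le_mul_of_nonneg_left hKr (by positivity)) le_rfl
    (step_zone_exp blkX blkY blkZ hρ hPr hw hT N hθ hc₂ hr hrδ h₁ h₂)

/-- `step_exp_zone` (→ shape, rate `r/3`) with named outputs and `K ≤ K_x`. [cite: Balaban1984PropagatorsII, p.238, (2.60)–(2.61) p.234] -/
private theorem sEZ (blkX : X → g.Site) (blkY : Y → g.Site) (blkZ : Z → g.Site) (hρ : IsPseudoDist g.dist)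
    {β : g.Site → ℝ} (hβ : IsDepth g.dist β) {K : ℝ → ℝ} (hK : ∀ a, 0 < a → 0 ≤ K a) (hPr : Profile g.dist (fun a : g.Site => a) K)
    (N : Finset g.Site) (hN : ∀ a ∈ N, β a = 0)
    {w : g.Site → ℝ} (hw : ∀ a, 0 < w a) {κ Λ : ℝ} (hΛ : 0 ≤ Λ) (hT : ∀ a c, Real.exp (-(κ * g.dist a c)) * w c ≤ Λ * w a)
    {T₁ : (Y → ℝ) →ₗ[ℝ] (Z → ℝ)} {T₂ : (X → ℝ) →ₗ[ℝ] (Y → ℝ)} {γ₁ γ₂ : ℤ} {c₁ δ₁ θ r Kx : ℝ} (γ : ℤ) (n : ℕ) (r' c : ℝ)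
    (hγ : γ₁ + γ₂ = γ) (hn : γ₂.natAbs = n) (hr' : r / 3 = r') (hc : Λ ^ n * c₁ * θ * Kx = c) (hKr : K r' ≤ Kx)
    (hc₁ : 0 ≤ c₁) (hθ : 0 ≤ θ) (hr : 0 < r) (hrδ : r + n * κ ≤ δ₁)
    (h₁ : HasMajorantHom blkY blkZ T₁ (fun a b => w a ^ γ₁ * expK g c₁ δ₁ a b))
    (h₂ : HasMajorantHom blkX blkY T₂ (fun a b => w a ^ γ₂ * zoneK g N θ r a b)) :
    HasMajorantHom blkX blkZ (T₁ ∘ₗ T₂) (fun a b => w a ^ γ * shapeK g β c r' a b) := by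
  subst hγ hr' hn hc
  have hK2 : 0 ≤ K (r / 3) := hK _ (by positivity)
  exact hom_weaken_shape blkX blkZ hρ hβ hw (by positivity) (mul_le_mul_of_nonneg_left hKr (by positivity)) le_rfl
    (step_exp_zone blkX blkY blkZ hρ hβ hPr N hN hw hT hc₁ hθ hr hrδ h₁ h₂)

omit [DecidableEq g.Site] in
/-- `step_exp_shape` with named outputs and `K ≤ K_x`. [cite: Balaban1984PropagatorsII, (2.52)–(2.55) p.232, (2.60)–(2.61) p.234, p.238] -/
private theorem sES (blkX : X → g.Site) (blkY : Y → g.Site) (blkZ : Z → g.Site) (hρ : IsPseudoDist g.dist)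
    {β : g.Site → ℝ} (hβ : IsDepth g.dist β) {K : ℝ → ℝ} (hK : ∀ a, 0 < a → 0 ≤ K a) (hPr : Profile g.dist (fun a : g.Site => a) K)
    {w : g.Site → ℝ} (hw : ∀ a, 0 < w a) {κ Λ : ℝ} (hΛ : 0 ≤ Λ) (hT : ∀ a c, Real.exp (-(κ * g.dist a c)) * w c ≤ Λ * w a)
    {T₁ : (Y → ℝ) →ₗ[ℝ] (Z → ℝ)} {T₂ : (X → ℝ) →ₗ[ℝ] (Y → ℝ)} {γ₁ γ₂ : ℤ} {c₁ δ₁ ε r Kx : ℝ} (γ : ℤ) (n : ℕ) (r' c : ℝ)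
    (hγ : γ₁ + γ₂ = γ) (hn : γ₂.natAbs = n) (hr' : r / 2 = r') (hc : Λ ^ n * c₁ * ε * Kx = c) (hKr : K r' ≤ Kx)
    (hc₁ : 0 ≤ c₁) (hε : 0 ≤ ε) (hr : 0 < r) (hrδ : r + n * κ ≤ δ₁)
    (h₁ : HasMajorantHom blkY blkZ T₁ (fun a b => w a ^ γ₁ * expK g c₁ δ₁ a b))
    (h₂ : HasMajorantHom blkX blkY T₂ (fun a b => w a ^ γ₂ * shapeK g β ε r a b)) :
    HasMajorantHom blkX blkZ (T₁ ∘ₗ T₂) (fun a b => w a ^ γ * shapeK g β c r' a b) := by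
  subst hγ hr' hn hc
  have hK2 : 0 ≤ K (r / 2) := hK _ (by positivity)
  exact hom_weaken_shape blkX blkZ hρ hβ hw (by positivity) (mul_le_mul_of_nonneg_left hKr (by positivity)) le_rfl
    (step_exp_shape blkX blkY blkZ hρ hβ hPr hw hT hc₁ hε hr hrδ h₁ h₂)

end Wrappers

/-! ## §2  The displayed inputs in weight form (`w^γ·expK`, `w^γ·zoneK`) -/

section Inputs

variable [DecidableEq g.Site] {X Y : Type}

omit [DecidableEq g.Site] in
/-- (2.67)₁ shape `B·w²·e^{−δd}` as `w^{(2:ℤ)}·expK(B, δ)`. [cite: Balaban1984PropagatorsII, (2.67) p.235] -/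
private theorem cvW2 (blk : X → g.Site) {T : Module.End ℝ (X → ℝ)} {w : g.Site → ℝ} {B δ : ℝ}
    (h : HasMajorant blk T (fun a b => B * w a ^ 2 * Real.exp (-(δ * g.dist a b)))) :
    HasMajorantHom blk blk T (fun a b => w a ^ (2 : ℤ) * expK g B δ a b) :=
  (hasMajorantHom_iff blk T _).2 (hasMajorant_mono blk h fun a b => le_of_eq (by rw [expK_apply, zpow_ofNat]; ring))

omit [DecidableEq g.Site] in
/-- (2.87)-type shape `B·w^{−4}·e^{−δd}` as `w^{(−4:ℤ)}·expK(B, δ)`. [cite: Balaban1984PropagatorsII, (2.87) p.238] -/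
private theorem cvWm4 (blk : X → g.Site) {T : Module.End ℝ (X → ℝ)} {w : g.Site → ℝ} {B δ : ℝ}
    (h : HasMajorant blk T (fun a b => B * (w a ^ 4)⁻¹ * Real.exp (-(δ * g.dist a b)))) :
    HasMajorantHom blk blk T (fun a b => w a ^ (-4 : ℤ) * expK g B δ a b) :=
  (hasMajorantHom_iff blk T _).2 (hasMajorant_mono blk h fun a b => le_of_eq (by rw [expK_apply, zpow_neg, zpow_ofNat]; ring))

omit [DecidableEq g.Site] in
/-- (2.67)₂,₃ shape `C·w·e^{−δd}` (a leg) as `w^{(1:ℤ)}·expK(C, δ)`. [cite: Balaban1984PropagatorsII, (2.67) p.235] -/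
private theorem cvW1 (blkX : X → g.Site) (blkY : Y → g.Site) {T : (X → ℝ) →ₗ[ℝ] (Y → ℝ)} {w : g.Site → ℝ} {C δ : ℝ}
    (h : HasMajorantHom blkX blkY T (fun a b => C * w a * Real.exp (-(δ * g.dist a b)))) :
    HasMajorantHom blkX blkY T (fun a b => w a ^ (1 : ℤ) * expK g C δ a b) :=
  hasMajorantHom_mono blkX blkY h fun a b => le_of_eq (by rw [expK_apply, zpow_one]; ring)

/-- a zone kernel `1_N(y)θe^{−δd}` as `w^{(0:ℤ)}·zoneK(N, θ, δ)`. [cite: Balaban1984PropagatorsII, p.238] -/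
private theorem cvZ0 (blk : X → g.Site) (N : Finset g.Site) {T : Module.End ℝ (X → ℝ)} {w : g.Site → ℝ} {θ δ : ℝ}
    (h : HasMajorant blk T (fun a b => (if a ∈ N then θ else 0) * Real.exp (-(δ * g.dist a b)))) :
    HasMajorantHom blk blk T (fun a b => w a ^ (0 : ℤ) * zoneK g N θ δ a b) :=
  (hasMajorantHom_iff blk T _).2 (hasMajorant_mono blk h fun a b => le_of_eq (by rw [zoneK_apply, zpow_zero, one_mul]))

/-- a zone leg kernel `1_N(y)θ₁w^{−1}e^{−δd}` as `w^{(−1:ℤ)}·zoneK(N, θ₁, δ)`. [cite: Balaban1984PropagatorsII, p.238] -/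
private theorem cvZm1 (blkX : X → g.Site) (blkY : Y → g.Site) (N : Finset g.Site) {T : (X → ℝ) →ₗ[ℝ] (Y → ℝ)} {w : g.Site → ℝ}
    {θ δ : ℝ} (h : HasMajorantHom blkX blkY T (fun a b => (if a ∈ N then θ else 0) * (w a)⁻¹ * Real.exp (-(δ * g.dist a b)))) :
    HasMajorantHom blkX blkY T (fun a b => w a ^ (-1 : ℤ) * zoneK g N θ δ a b) :=
  hasMajorantHom_mono blkX blkY h fun a b => le_of_eq (by rw [zoneK_apply, zpow_neg_one]; ring)

omit [DecidableEq g.Site] in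
/-- `1 − χ` as a multiplication operator. [cite: Balaban1984PropagatorsII, p.238 («1 − χ»: the region where the cutoff is not 1)] -/
private theorem one_sub_mulOp (χ : X → ℝ) : (1 : Module.End ℝ (X → ℝ)) - mulOp χ = mulOp (fun x => 1 - χ x) := by
  apply LinearMap.ext
  intro μ
  funext x
  simp only [LinearMap.sub_apply, Pi.sub_apply, Module.End.one_apply, mulOp_apply]
  ring

end Inputs

/-! ## §3  Line 3 of (2.92): the block-majorant sizes of `ζ_□∂(P − P_□)∂*h_□` -/

section Main

variable [DecidableEq g.Site] {Xs Y : Type}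

omit [DecidableEq g.Site] in
/-- **THE SEVEN CHAINS OF `ζ∂(P − P_□)∂*h`** (operator identity): insert the site cut `c_L` behind the left leg (`(ζ∂)·c_L = ζ∂`), expand `c_L·(G′SG′ −
G′_□S_□G′_□)` by `domainChangeP_expand7_left`, re-absorb `c_L`, distribute the legs — the sum of the seven composed chains the majorant sizes are built on
(`K := [χ, Δ′_a] = χΔ′ − Δ′χ` as operators, `1 − χ` as the multiplier `mulOp (1 − χ)`). [cite: Balaban1984PropagatorsII, (2.92) p.239 (line 3), p.238, (2.17) p.225] -/
theorem line3P_expand {G D Gw S Sw : Module.End ℝ (Xs → ℝ)} {χ cL : Xs → ℝ} {EL₀ : (Xs → ℝ) →ₗ[ℝ] (Y → ℝ)}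
    {ER₀ : (Y → ℝ) →ₗ[ℝ] (Xs → ℝ)} {ζ h : Y → ℝ}
    (hGD : G * D = 1) (hDG : D * G = 1) (hχGw : mulOp χ * D * Gw = mulOp χ)
    (hS1 : Sw * (G * G) * S = Sw) (hS2 : Gw * Sw * (Gw * Gw) * S = Gw * S)
    (hcL : ∀ x, cL x * χ x = cL x) (hEL : (mulOp ζ ∘ₗ EL₀) ∘ₗ mulOp cL = mulOp ζ ∘ₗ EL₀) :
    mulOp ζ * ((EL₀ ∘ₗ (G * S * G - Gw * Sw * Gw)) ∘ₗ ER₀) * mulOp h =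
      mulOp ζ * (((EL₀ ∘ₗ G) ∘ₗ (((mulOp χ * D - D * mulOp χ) * Gw - (mulOp χ * D - D * mulOp χ) * G) ∘ₗ (S ∘ₗ (G ∘ₗ ER₀)))) +
        ((EL₀ ∘ₗ Gw) ∘ₗ (Sw ∘ₗ (Gw ∘ₗ (G ∘ₗ (((mulOp χ * D - D * mulOp χ) * G - (mulOp χ * D - D * mulOp χ) * Gw) ∘ₗ (S ∘ₗ (G ∘ₗ ER₀))))))) +
        ((EL₀ ∘ₗ Gw) ∘ₗ (Sw ∘ₗ (Gw ∘ₗ ((mulOp (fun x => 1 - χ x) ∘ₗ (Gw - G)) ∘ₗ (S ∘ₗ (G ∘ₗ ER₀)))))) +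
        ((EL₀ ∘ₗ Gw) ∘ₗ (Sw ∘ₗ (G ∘ₗ (((mulOp χ * D - D * mulOp χ) * G - (mulOp χ * D - D * mulOp χ) * Gw) ∘ₗ (G ∘ₗ (S ∘ₗ (G ∘ₗ ER₀))))))) +
        ((EL₀ ∘ₗ Gw) ∘ₗ (Sw ∘ₗ ((mulOp (fun x => 1 - χ x) ∘ₗ (Gw - G)) ∘ₗ (G ∘ₗ (S ∘ₗ (G ∘ₗ ER₀)))))) +
        ((EL₀ ∘ₗ Gw) ∘ₗ (Sw ∘ₗ (G ∘ₗ ((mulOp χ * D - D * mulOp χ) ∘ₗ (Gw ∘ₗ ER₀) - (mulOp χ * D - D * mulOp χ) ∘ₗ (G ∘ₗ ER₀))))) +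
        ((EL₀ ∘ₗ Gw) ∘ₗ (Sw ∘ₗ (mulOp (fun x => 1 - χ x) ∘ₗ (G ∘ₗ ER₀ - Gw ∘ₗ ER₀))))) * mulOp h := by
  set Kop : Module.End ℝ (Xs → ℝ) := mulOp χ * D - D * mulOp χ with hKop
  have hL' : mulOp cL * mulOp χ = mulOp cL := by
    rw [mulOp_mul_mulOp]; congr 1; funext x; exact hcL x
  have hexp := domainChangeP_expand7_left (A := Module.End ℝ (Xs → ℝ)) (S := S) (Sw := Sw) hGD hDG hχGw hS1 hS2 hL'
  rw [one_sub_mulOp χ, ← hKop] at hexp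
  have hfac : mulOp cL * (G * S * G - Gw * Sw * Gw) =
      mulOp cL * (G * ((Kop * Gw - Kop * G) * (S * G)) + Gw * (Sw * (Gw * (G * ((Kop * G - Kop * Gw) * (S * G))))) +
        Gw * (Sw * (Gw * ((mulOp (fun x => 1 - χ x) * (Gw - G)) * (S * G)))) + Gw * (Sw * (G * ((Kop * G - Kop * Gw) * (G * (S * G))))) +
        Gw * (Sw * ((mulOp (fun x => 1 - χ x) * (Gw - G)) * (G * (S * G)))) + Gw * (Sw * (G * (Kop * Gw - Kop * G))) +
        Gw * (Sw * (mulOp (fun x => 1 - χ x) * (G - Gw)))) := by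
    rw [hexp]; simp only [mul_add, mul_sub, sub_mul, mul_assoc]
  have key : (mulOp ζ ∘ₗ EL₀) ∘ₗ (G * S * G - Gw * Sw * Gw) =
      (mulOp ζ ∘ₗ EL₀) ∘ₗ (G * ((Kop * Gw - Kop * G) * (S * G)) + Gw * (Sw * (Gw * (G * ((Kop * G - Kop * Gw) * (S * G))))) +
        Gw * (Sw * (Gw * ((mulOp (fun x => 1 - χ x) * (Gw - G)) * (S * G)))) + Gw * (Sw * (G * ((Kop * G - Kop * Gw) * (G * (S * G))))) +
        Gw * (Sw * ((mulOp (fun x => 1 - χ x) * (Gw - G)) * (G * (S * G)))) + Gw * (Sw * (G * (Kop * Gw - Kop * G))) +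
        Gw * (Sw * (mulOp (fun x => 1 - χ x) * (G - Gw)))) := by
    conv_lhs => rw [← hEL, LinearMap.comp_assoc, ← Module.End.mul_eq_comp, hfac, Module.End.mul_eq_comp, ← LinearMap.comp_assoc, hEL]
  have e1 : mulOp ζ * ((EL₀ ∘ₗ (G * S * G - Gw * Sw * Gw)) ∘ₗ ER₀) * mulOp h =
      (((mulOp ζ ∘ₗ EL₀) ∘ₗ (G * S * G - Gw * Sw * Gw)) ∘ₗ ER₀) ∘ₗ mulOp h := by
    simp only [Module.End.mul_eq_comp, LinearMap.comp_assoc]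
  rw [e1, key]
  simp only [Module.End.mul_eq_comp, LinearMap.comp_assoc, LinearMap.comp_add, LinearMap.add_comp, LinearMap.comp_sub, LinearMap.sub_comp]

set_option maxHeartbeats 1600000 in
/-- **(2.92) LINE 3 — THE CHANGE OF DOMAIN FOR `P` HAS THE MAJORANT `C_D(L^jη)^{−2}e^{−c_DM₀}e^{−rd}`** (the displayed hypothesis `hD` of the (2.134)
diagonal theorems, from displayed factor majorants).  DATA: fine lattices `X_s` (sites, `blkS`), `Y` (bonds, `blkY`) over `𝔅`; weight `w > 0`; pseudo-distance
`d` ((2.46)/(2.54)); depth `β` vanishing on the zone `N`; profile `K` of (2.61) bounded by `K_x` on `[δ/192, ∞)`; transfer `e^{−κd}w(y″) ≤ Λw(y)` ((2.60)) with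
`6κ ≤ δ`.  OPERATORS: `G` (`G′` global: `GΔ′ = Δ′G = 1`), `Gw` (`G′_□`: `χΔ′G′_□ = χ`), sandwiches `S`, `Sw` (`S_□G′²S = S_□`, `G′_□S_□G′_□²S = G′_□S`),
cutoff `χ : X_s → [0,1]`, `= 1` off `N`; site cut `c_L` with `c_Lχ = c_L` absorbed by the left leg (`(ζ∂)·c_L = ζ∂`); legs `EL₀ = ∂`, `ER₀ = ∂*`; bond cut-offs
`ζ`, `h` (`|·| ≤ 1`) at depth `≥ M₀`.  INPUTS: (2.67)₁ `B₁w²e^{−δd}` for `G`, `Gw`; (2.87)-type `B_Sw^{−4}e^{−δd}` for `S`, `Sw`; legs `C₁we^{−δd}` for `∂G′`,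
`∂G′_□`, `G′∂*`, `G′_□∂*`; zone kernels `1_Nθe^{−δd}` for `[χ,Δ′]G′`, `[χ,Δ′]G′_□`, `1_Nθ₁w^{−1}e^{−δd}` for `[χ,Δ′]G′∂*`, `[χ,Δ′]G′_□∂*`.  CONCLUSION:
`|ζ∂(G′SG′ − G′_□S_□G′_□)∂*h|` has the `𝔅`-majorant `C_D·e^{−(δ/96)M₀}/w(y)²·e^{−(δ/192)d(y,y′)}`, `C_D = CDtot Λ B₁ B_S C₁ θ θ₁ K_x` — *"an estimate has the
factor e^{−δ₀M} because of the usual estimate of the type (1.12) [3] connected with a change of a domain"*, at the certificate's rates (D-b06.21).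
[cite: Balaban1984PropagatorsII, (2.92) p.239 (line 3), p.238, (2.134) p.247, (2.67) p.235, (2.87) p.238, (2.60)–(2.61) p.234] -/
theorem line3P_hasMajorant (blkS : Xs → g.Site) (blkY : Y → g.Site)
    (hρ : IsPseudoDist g.dist) {β : g.Site → ℝ} (hβ : IsDepth g.dist β) {K : ℝ → ℝ} (hK : ∀ a, 0 < a → 0 ≤ K a)
    (hPr : Profile g.dist (fun a : g.Site => a) K) (N : Finset g.Site) (hN : ∀ a ∈ N, β a = 0)
    {w : g.Site → ℝ} (hw : ∀ a, 0 < w a) {κ Λ δ Kx : ℝ} (hΛ : 0 ≤ Λ)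
    (hT : ∀ a c, Real.exp (-(κ * g.dist a c)) * w c ≤ Λ * w a) (hδ : 0 < δ) (hκδ : 6 * κ ≤ δ)
    (hKx : ∀ a, δ / 192 ≤ a → K a ≤ Kx)
    {G D Gw S Sw : Module.End ℝ (Xs → ℝ)} {χ cL : Xs → ℝ} {EL₀ : (Xs → ℝ) →ₗ[ℝ] (Y → ℝ)} {ER₀ : (Y → ℝ) →ₗ[ℝ] (Xs → ℝ)} {ζ h : Y → ℝ}
    (hGD : G * D = 1) (hDG : D * G = 1) (hχGw : mulOp χ * D * Gw = mulOp χ)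
    (hS1 : Sw * (G * G) * S = Sw) (hS2 : Gw * Sw * (Gw * Gw) * S = Gw * S)
    (hcL : ∀ x, cL x * χ x = cL x) (hEL : (mulOp ζ ∘ₗ EL₀) ∘ₗ mulOp cL = mulOp ζ ∘ₗ EL₀)
    (hχ0 : ∀ x, 0 ≤ χ x) (hχ1 : ∀ x, χ x ≤ 1) (hχN : ∀ x, blkS x ∉ N → χ x = 1)
    (hζ1 : ∀ v, |ζ v| ≤ 1) (hh1 : ∀ v, |h v| ≤ 1) {M₀ : ℝ}
    (hζdeep : ∀ v, ζ v ≠ 0 → M₀ ≤ β (blkY v)) (hhdeep : ∀ v, h v ≠ 0 → M₀ ≤ β (blkY v))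
    {B₁ BS C₁ θ θ₁ : ℝ} (hB₁ : 0 ≤ B₁) (hBS : 0 ≤ BS) (hC₁ : 0 ≤ C₁) (hθ : 0 ≤ θ) (hθ₁ : 0 ≤ θ₁)
    (mG : HasMajorant blkS G (fun a b => B₁ * w a ^ 2 * Real.exp (-(δ * g.dist a b))))
    (mGw : HasMajorant blkS Gw (fun a b => B₁ * w a ^ 2 * Real.exp (-(δ * g.dist a b))))
    (mS : HasMajorant blkS S (fun a b => BS * (w a ^ 4)⁻¹ * Real.exp (-(δ * g.dist a b))))
    (mSw : HasMajorant blkS Sw (fun a b => BS * (w a ^ 4)⁻¹ * Real.exp (-(δ * g.dist a b))))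
    (mEG : HasMajorantHom blkS blkY (EL₀ ∘ₗ G) (fun a b => C₁ * w a * Real.exp (-(δ * g.dist a b))))
    (mEGw : HasMajorantHom blkS blkY (EL₀ ∘ₗ Gw) (fun a b => C₁ * w a * Real.exp (-(δ * g.dist a b))))
    (mGE : HasMajorantHom blkY blkS (G ∘ₗ ER₀) (fun a b => C₁ * w a * Real.exp (-(δ * g.dist a b))))
    (mGwE : HasMajorantHom blkY blkS (Gw ∘ₗ ER₀) (fun a b => C₁ * w a * Real.exp (-(δ * g.dist a b))))
    (mKG : HasMajorant blkS ((mulOp χ * D - D * mulOp χ) * G) (fun a b => (if a ∈ N then θ else 0) * Real.exp (-(δ * g.dist a b))))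
    (mKGw : HasMajorant blkS ((mulOp χ * D - D * mulOp χ) * Gw) (fun a b => (if a ∈ N then θ else 0) * Real.exp (-(δ * g.dist a b))))
    (mKGE : HasMajorantHom blkY blkS ((mulOp χ * D - D * mulOp χ) ∘ₗ (G ∘ₗ ER₀))
      (fun a b => (if a ∈ N then θ₁ else 0) * (w a)⁻¹ * Real.exp (-(δ * g.dist a b))))
    (mKGwE : HasMajorantHom blkY blkS ((mulOp χ * D - D * mulOp χ) ∘ₗ (Gw ∘ₗ ER₀))
      (fun a b => (if a ∈ N then θ₁ else 0) * (w a)⁻¹ * Real.exp (-(δ * g.dist a b)))) :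
    HasMajorant blkY (mulOp ζ * ((EL₀ ∘ₗ (G * S * G - Gw * Sw * Gw)) ∘ₗ ER₀) * mulOp h)
      (fun a b => CDtot Λ B₁ BS C₁ θ θ₁ Kx * Real.exp (-(δ / 96 * M₀)) / w a ^ 2 * Real.exp (-(δ / 192 * g.dist a b))) := by
  -- the cutoff complement and the commutator
  set Kop : Module.End ℝ (Xs → ℝ) := mulOp χ * D - D * mulOp χ with hKop
  set c1 : Xs → ℝ := fun x => 1 - χ x with hc1
  have hc1abs : ∀ x, |c1 x| ≤ 1 := fun x => by
    rw [hc1]; exact abs_le.2 ⟨by linarith [hχ1 x], by linarith [hχ0 x]⟩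
  have hc1N : ∀ x, blkS x ∉ N → c1 x = 0 := fun x hx => by rw [hc1]; simp only [hχN x hx, sub_self]
  have hKx' : 0 ≤ Kx := (hK _ (by positivity)).trans (hKx (δ / 192) le_rfl)
  -- inputs in weight form
  have cG := cvW2 blkS mG
  have cGw := cvW2 blkS mGw
  have cS := cvWm4 blkS mS
  have cSw := cvWm4 blkS mSw
  have cEG := cvW1 blkS blkY mEG
  have cEGw := cvW1 blkS blkY mEGw
  have cGE := cvW1 blkY blkS mGE
  have cGwE := cvW1 blkY blkS mGwE
  have cKG : HasMajorantHom blkS blkS (Kop * G) (fun a b => w a ^ (0 : ℤ) * zoneK g N θ δ a b) := cvZ0 blkS N mKG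
  have cKGw : HasMajorantHom blkS blkS (Kop * Gw) (fun a b => w a ^ (0 : ℤ) * zoneK g N θ δ a b) := cvZ0 blkS N mKGw
  have cKGE : HasMajorantHom blkY blkS (Kop ∘ₗ (G ∘ₗ ER₀)) (fun a b => w a ^ (-1 : ℤ) * zoneK g N θ₁ δ a b) := cvZm1 blkY blkS N mKGE
  have cKGwE : HasMajorantHom blkY blkS (Kop ∘ₗ (Gw ∘ₗ ER₀)) (fun a b => w a ^ (-1 : ℤ) * zoneK g N θ₁ δ a b) := cvZm1 blkY blkS N mKGwE
  -- derived pieces: the right leg at rate δ/2, the zone factors, the (1 − χ)-cuts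
  have hδ2 : δ / 2 ≤ δ := by linarith
  have cGE2 : HasMajorantHom blkY blkS (G ∘ₗ ER₀) (fun a b => w a ^ (1 : ℤ) * expK g C₁ (δ / 2) a b) :=
    hom_weaken_exp blkY blkS hρ hw hC₁ le_rfl hδ2 cGE
  have cZl : HasMajorantHom blkS blkS (Kop * Gw - Kop * G) (fun a b => w a ^ (0 : ℤ) * zoneK g N (θ + θ) δ a b) :=
    hom_sub_zone blkS blkS N cKGw cKG
  have cZl' : HasMajorantHom blkS blkS (Kop * G - Kop * Gw) (fun a b => w a ^ (0 : ℤ) * zoneK g N (θ + θ) δ a b) :=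
    hom_sub_zone blkS blkS N cKG cKGw
  have cZlE : HasMajorantHom blkY blkS (Kop ∘ₗ (Gw ∘ₗ ER₀) - Kop ∘ₗ (G ∘ₗ ER₀)) (fun a b => w a ^ (-1 : ℤ) * zoneK g N (θ₁ + θ₁) (δ / 2) a b) :=
    hom_weaken_zone blkY blkS hρ hw N (by positivity) le_rfl hδ2 (hom_sub_zone blkY blkS N cKGwE cKGE)
  have cY1 : HasMajorantHom blkS blkS (mulOp c1 ∘ₗ (Gw - G)) (fun a b => w a ^ (2 : ℤ) * zoneK g N (B₁ + B₁) δ a b) :=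
    hom_zoneCut_exp blkS blkS (hom_sub_exp blkS blkS cGw cG) c1 hc1abs N hc1N
  have cY2 : HasMajorantHom blkY blkS (mulOp c1 ∘ₗ (G ∘ₗ ER₀ - Gw ∘ₗ ER₀)) (fun a b => w a ^ (1 : ℤ) * zoneK g N (C₁ + C₁) (δ / 2) a b) :=
    hom_weaken_zone blkY blkS hρ hw N (by positivity) le_rfl hδ2 (hom_zoneCut_exp blkY blkS (hom_sub_exp blkY blkS cGE cGwE) c1 hc1abs N hc1N)
  -- rate bookkeeping
  have hK4 : K (δ / 4) ≤ Kx := hKx _ (by linarith)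
  have hK8 : K (δ / 8) ≤ Kx := hKx _ (by linarith)
  have hK16 : K (δ / 16) ≤ Kx := hKx _ (by linarith)
  have hK24 : K (δ / 24) ≤ Kx := hKx _ (by linarith)
  have hK48 : K (δ / 48) ≤ Kx := hKx _ (by linarith)
  have hK96 : K (δ / 96) ≤ Kx := hKx _ (by linarith)
  have hK192 : K (δ / 192) ≤ Kx := hKx _ le_rfl
  have hK6 : K (δ / 6) ≤ Kx := hKx _ (by linarith)
  have hK12 : K (δ / 12) ≤ Kx := hKx _ (by linarith)
  have hn1 : ((1 : ℤ).natAbs) = 1 := rfl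
  have hn3 : ((-3 : ℤ).natAbs) = 3 := rfl
  have hnm1 : ((-1 : ℤ).natAbs) = 1 := rfl
  -- the common right piece `S·G′∂*` (weight −3, rate δ/4) and `G′·S·G′∂*` (weight −1, rate δ/8)
  obtain ⟨cSG, hcSG⟩ : ∃ c : ℝ, Λ ^ 1 * BS * C₁ * Kx = c := ⟨_, rfl⟩
  have hcSG0 : 0 ≤ cSG := by rw [← hcSG]; positivity
  have hP0 : HasMajorantHom blkY blkS (S ∘ₗ (G ∘ₗ ER₀)) (fun a b => w a ^ (-3 : ℤ) * expK g cSG (δ / 4) a b) :=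
    sEE blkY blkS blkS hρ hK hPr hw hΛ hT (-3) 1 (δ / 4) cSG (by norm_num) hn1 (by ring) hcSG hK4 hBS hC₁ (by positivity)
      (by push_cast; linarith) cS cGE2
  obtain ⟨cE4, hcE4⟩ : ∃ c : ℝ, Λ ^ 3 * B₁ * cSG * Kx = c := ⟨_, rfl⟩
  have hcE40 : 0 ≤ cE4 := by rw [← hcE4]; positivity
  have hE4 : HasMajorantHom blkY blkS (G ∘ₗ (S ∘ₗ (G ∘ₗ ER₀))) (fun a b => w a ^ (-1 : ℤ) * expK g cE4 (δ / 8) a b) :=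
    sEE blkY blkS blkS hρ hK hPr hw hΛ hT (-1) 3 (δ / 8) cE4 (by norm_num) hn3 (by ring) hcE4 hK8 hB₁ hcSG0 (by positivity)
      (by push_cast; linarith) cG hP0
  -- T1 = ∂G′ · [χ,Δ′](G′_□ − G′) · S · G′∂*
  obtain ⟨cZ1, hcZ1⟩ : ∃ c : ℝ, Λ ^ 3 * (θ + θ) * cSG * Kx = c := ⟨_, rfl⟩
  have hcZ10 : 0 ≤ cZ1 := by rw [← hcZ1]; positivity
  have hZ1 : HasMajorantHom blkY blkS ((Kop * Gw - Kop * G) ∘ₗ (S ∘ₗ (G ∘ₗ ER₀))) (fun a b => w a ^ (-3 : ℤ) * zoneK g N cZ1 (δ / 8) a b) :=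
    sZE blkY blkS blkS hρ hK hPr N hw hΛ hT (-3) 3 (δ / 8) cZ1 (by norm_num) hn3 (by ring) hcZ1 hK8 (by positivity) hcSG0 (by positivity)
      (by push_cast; linarith) cZl hP0
  obtain ⟨e1, he1⟩ : ∃ c : ℝ, Λ ^ 3 * C₁ * cZ1 * Kx = c := ⟨_, rfl⟩
  have he10 : 0 ≤ e1 := by rw [← he1]; positivity
  have hT1 : HasMajorantHom blkY blkY ((EL₀ ∘ₗ G) ∘ₗ ((Kop * Gw - Kop * G) ∘ₗ (S ∘ₗ (G ∘ₗ ER₀))))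
      (fun a b => w a ^ (-2 : ℤ) * shapeK g β e1 (δ / 24) a b) :=
    sEZ blkY blkS blkY hρ hβ hK hPr N hN hw hΛ hT (-2) 3 (δ / 24) e1 (by norm_num) hn3 (by ring) he1 hK24 hC₁ hcZ10 (by positivity)
      (by push_cast; linarith) cEG hZ1
  -- T2 = ∂G′_□ · S_□ · G′_□ · G′[χ,Δ′](G′ − G′_□) · S · G′∂*
  have hZ2 : HasMajorantHom blkY blkS ((Kop * G - Kop * Gw) ∘ₗ (S ∘ₗ (G ∘ₗ ER₀))) (fun a b => w a ^ (-3 : ℤ) * zoneK g N cZ1 (δ / 8) a b) :=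
    sZE blkY blkS blkS hρ hK hPr N hw hΛ hT (-3) 3 (δ / 8) cZ1 (by norm_num) hn3 (by ring) hcZ1 hK8 (by positivity) hcSG0 (by positivity)
      (by push_cast; linarith) cZl' hP0
  obtain ⟨c2a, hc2a⟩ : ∃ c : ℝ, Λ ^ 3 * B₁ * cZ1 * Kx = c := ⟨_, rfl⟩
  have hc2a0 : 0 ≤ c2a := by rw [← hc2a]; positivity
  have h2a : HasMajorantHom blkY blkS (G ∘ₗ ((Kop * G - Kop * Gw) ∘ₗ (S ∘ₗ (G ∘ₗ ER₀))))
      (fun a b => w a ^ (-1 : ℤ) * shapeK g β c2a (δ / 24) a b) :=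
    sEZ blkY blkS blkS hρ hβ hK hPr N hN hw hΛ hT (-1) 3 (δ / 24) c2a (by norm_num) hn3 (by ring) hc2a hK24 hB₁ hcZ10 (by positivity)
      (by push_cast; linarith) cG hZ2
  obtain ⟨c2b, hc2b⟩ : ∃ c : ℝ, Λ ^ 1 * B₁ * c2a * Kx = c := ⟨_, rfl⟩
  have hc2b0 : 0 ≤ c2b := by rw [← hc2b]; positivity
  have h2b : HasMajorantHom blkY blkS (Gw ∘ₗ (G ∘ₗ ((Kop * G - Kop * Gw) ∘ₗ (S ∘ₗ (G ∘ₗ ER₀)))))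
      (fun a b => w a ^ (1 : ℤ) * shapeK g β c2b (δ / 48) a b) :=
    sES blkY blkS blkS hρ hβ hK hPr hw hΛ hT 1 1 (δ / 48) c2b (by norm_num) hnm1 (by ring) hc2b hK48 hB₁ hc2a0 (by positivity)
      (by push_cast; linarith) cGw h2a
  obtain ⟨c2c, hc2c⟩ : ∃ c : ℝ, Λ ^ 1 * BS * c2b * Kx = c := ⟨_, rfl⟩
  have hc2c0 : 0 ≤ c2c := by rw [← hc2c]; positivity
  have h2c : HasMajorantHom blkY blkS (Sw ∘ₗ (Gw ∘ₗ (G ∘ₗ ((Kop * G - Kop * Gw) ∘ₗ (S ∘ₗ (G ∘ₗ ER₀))))))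
      (fun a b => w a ^ (-3 : ℤ) * shapeK g β c2c (δ / 96) a b) :=
    sES blkY blkS blkS hρ hβ hK hPr hw hΛ hT (-3) 1 (δ / 96) c2c (by norm_num) hn1 (by ring) hc2c hK96 hBS hc2b0 (by positivity)
      (by push_cast; linarith) cSw h2b
  obtain ⟨e2, he2⟩ : ∃ c : ℝ, Λ ^ 3 * C₁ * c2c * Kx = c := ⟨_, rfl⟩
  have he20 : 0 ≤ e2 := by rw [← he2]; positivity
  have hT2 : HasMajorantHom blkY blkY ((EL₀ ∘ₗ Gw) ∘ₗ (Sw ∘ₗ (Gw ∘ₗ (G ∘ₗ ((Kop * G - Kop * Gw) ∘ₗ (S ∘ₗ (G ∘ₗ ER₀)))))))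
      (fun a b => w a ^ (-2 : ℤ) * shapeK g β e2 (δ / 192) a b) :=
    sES blkY blkS blkY hρ hβ hK hPr hw hΛ hT (-2) 3 (δ / 192) e2 (by norm_num) hn3 (by ring) he2 hK192 hC₁ hc2c0 (by positivity)
      (by push_cast; linarith) cEGw h2c
  -- T3 = ∂G′_□ · S_□ · G′_□ · (1 − χ)(G′_□ − G′) · S · G′∂*
  obtain ⟨cY3, hcY3⟩ : ∃ c : ℝ, Λ ^ 3 * (B₁ + B₁) * cSG * Kx = c := ⟨_, rfl⟩
  have hcY30 : 0 ≤ cY3 := by rw [← hcY3]; positivity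
  have hY3 : HasMajorantHom blkY blkS ((mulOp c1 ∘ₗ (Gw - G)) ∘ₗ (S ∘ₗ (G ∘ₗ ER₀))) (fun a b => w a ^ (-1 : ℤ) * zoneK g N cY3 (δ / 8) a b) :=
    sZE blkY blkS blkS hρ hK hPr N hw hΛ hT (-1) 3 (δ / 8) cY3 (by norm_num) hn3 (by ring) hcY3 hK8 (by positivity) hcSG0 (by positivity)
      (by push_cast; linarith) cY1 hP0
  obtain ⟨c3a, hc3a⟩ : ∃ c : ℝ, Λ ^ 1 * B₁ * cY3 * Kx = c := ⟨_, rfl⟩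
  have hc3a0 : 0 ≤ c3a := by rw [← hc3a]; positivity
  have h3a : HasMajorantHom blkY blkS (Gw ∘ₗ ((mulOp c1 ∘ₗ (Gw - G)) ∘ₗ (S ∘ₗ (G ∘ₗ ER₀))))
      (fun a b => w a ^ (1 : ℤ) * shapeK g β c3a (δ / 24) a b) :=
    sEZ blkY blkS blkS hρ hβ hK hPr N hN hw hΛ hT 1 1 (δ / 24) c3a (by norm_num) hnm1 (by ring) hc3a hK24 hB₁ hcY30 (by positivity)
      (by push_cast; linarith) cGw hY3
  obtain ⟨c3b, hc3b⟩ : ∃ c : ℝ, Λ ^ 1 * BS * c3a * Kx = c := ⟨_, rfl⟩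
  have hc3b0 : 0 ≤ c3b := by rw [← hc3b]; positivity
  have h3b : HasMajorantHom blkY blkS (Sw ∘ₗ (Gw ∘ₗ ((mulOp c1 ∘ₗ (Gw - G)) ∘ₗ (S ∘ₗ (G ∘ₗ ER₀)))))
      (fun a b => w a ^ (-3 : ℤ) * shapeK g β c3b (δ / 48) a b) :=
    sES blkY blkS blkS hρ hβ hK hPr hw hΛ hT (-3) 1 (δ / 48) c3b (by norm_num) hn1 (by ring) hc3b hK48 hBS hc3a0 (by positivity)
      (by push_cast; linarith) cSw h3a
  obtain ⟨e3, he3⟩ : ∃ c : ℝ, Λ ^ 3 * C₁ * c3b * Kx = c := ⟨_, rfl⟩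
  have he30 : 0 ≤ e3 := by rw [← he3]; positivity
  have hT3 : HasMajorantHom blkY blkY ((EL₀ ∘ₗ Gw) ∘ₗ (Sw ∘ₗ (Gw ∘ₗ ((mulOp c1 ∘ₗ (Gw - G)) ∘ₗ (S ∘ₗ (G ∘ₗ ER₀))))))
      (fun a b => w a ^ (-2 : ℤ) * shapeK g β e3 (δ / 96) a b) :=
    sES blkY blkS blkY hρ hβ hK hPr hw hΛ hT (-2) 3 (δ / 96) e3 (by norm_num) hn3 (by ring) he3 hK96 hC₁ hc3b0 (by positivity)
      (by push_cast; linarith) cEGw h3b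
  -- T4 = ∂G′_□ · S_□ · G′[χ,Δ′](G′ − G′_□) · G′ · S · G′∂*
  obtain ⟨cZ4, hcZ4⟩ : ∃ c : ℝ, Λ ^ 1 * (θ + θ) * cE4 * Kx = c := ⟨_, rfl⟩
  have hcZ40 : 0 ≤ cZ4 := by rw [← hcZ4]; positivity
  have hZ4 : HasMajorantHom blkY blkS ((Kop * G - Kop * Gw) ∘ₗ (G ∘ₗ (S ∘ₗ (G ∘ₗ ER₀)))) (fun a b => w a ^ (-1 : ℤ) * zoneK g N cZ4 (δ / 16) a b) :=
    sZE blkY blkS blkS hρ hK hPr N hw hΛ hT (-1) 1 (δ / 16) cZ4 (by norm_num) hnm1 (by ring) hcZ4 hK16 (by positivity) hcE40 (by positivity)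
      (by push_cast; linarith) cZl' hE4
  obtain ⟨c4a, hc4a⟩ : ∃ c : ℝ, Λ ^ 1 * B₁ * cZ4 * Kx = c := ⟨_, rfl⟩
  have hc4a0 : 0 ≤ c4a := by rw [← hc4a]; positivity
  have h4a : HasMajorantHom blkY blkS (G ∘ₗ ((Kop * G - Kop * Gw) ∘ₗ (G ∘ₗ (S ∘ₗ (G ∘ₗ ER₀)))))
      (fun a b => w a ^ (1 : ℤ) * shapeK g β c4a (δ / 48) a b) :=
    sEZ blkY blkS blkS hρ hβ hK hPr N hN hw hΛ hT 1 1 (δ / 48) c4a (by norm_num) hnm1 (by ring) hc4a hK48 hB₁ hcZ40 (by positivity)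
      (by push_cast; linarith) cG hZ4
  obtain ⟨c4b, hc4b⟩ : ∃ c : ℝ, Λ ^ 1 * BS * c4a * Kx = c := ⟨_, rfl⟩
  have hc4b0 : 0 ≤ c4b := by rw [← hc4b]; positivity
  have h4b : HasMajorantHom blkY blkS (Sw ∘ₗ (G ∘ₗ ((Kop * G - Kop * Gw) ∘ₗ (G ∘ₗ (S ∘ₗ (G ∘ₗ ER₀))))))
      (fun a b => w a ^ (-3 : ℤ) * shapeK g β c4b (δ / 96) a b) :=
    sES blkY blkS blkS hρ hβ hK hPr hw hΛ hT (-3) 1 (δ / 96) c4b (by norm_num) hn1 (by ring) hc4b hK96 hBS hc4a0 (by positivity)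
      (by push_cast; linarith) cSw h4a
  obtain ⟨e4, he4⟩ : ∃ c : ℝ, Λ ^ 3 * C₁ * c4b * Kx = c := ⟨_, rfl⟩
  have he40 : 0 ≤ e4 := by rw [← he4]; positivity
  have hT4 : HasMajorantHom blkY blkY ((EL₀ ∘ₗ Gw) ∘ₗ (Sw ∘ₗ (G ∘ₗ ((Kop * G - Kop * Gw) ∘ₗ (G ∘ₗ (S ∘ₗ (G ∘ₗ ER₀)))))))
      (fun a b => w a ^ (-2 : ℤ) * shapeK g β e4 (δ / 192) a b) :=
    sES blkY blkS blkY hρ hβ hK hPr hw hΛ hT (-2) 3 (δ / 192) e4 (by norm_num) hn3 (by ring) he4 hK192 hC₁ hc4b0 (by positivity)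
      (by push_cast; linarith) cEGw h4b
  -- T5 = ∂G′_□ · S_□ · (1 − χ)(G′_□ − G′) · G′ · S · G′∂*
  obtain ⟨cY5, hcY5⟩ : ∃ c : ℝ, Λ ^ 1 * (B₁ + B₁) * cE4 * Kx = c := ⟨_, rfl⟩
  have hcY50 : 0 ≤ cY5 := by rw [← hcY5]; positivity
  have hY5 : HasMajorantHom blkY blkS ((mulOp c1 ∘ₗ (Gw - G)) ∘ₗ (G ∘ₗ (S ∘ₗ (G ∘ₗ ER₀)))) (fun a b => w a ^ (1 : ℤ) * zoneK g N cY5 (δ / 16) a b) :=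
    sZE blkY blkS blkS hρ hK hPr N hw hΛ hT 1 1 (δ / 16) cY5 (by norm_num) hnm1 (by ring) hcY5 hK16 (by positivity) hcE40 (by positivity)
      (by push_cast; linarith) cY1 hE4
  obtain ⟨c5a, hc5a⟩ : ∃ c : ℝ, Λ ^ 1 * BS * cY5 * Kx = c := ⟨_, rfl⟩
  have hc5a0 : 0 ≤ c5a := by rw [← hc5a]; positivity
  have h5a : HasMajorantHom blkY blkS (Sw ∘ₗ ((mulOp c1 ∘ₗ (Gw - G)) ∘ₗ (G ∘ₗ (S ∘ₗ (G ∘ₗ ER₀)))))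
      (fun a b => w a ^ (-3 : ℤ) * shapeK g β c5a (δ / 48) a b) :=
    sEZ blkY blkS blkS hρ hβ hK hPr N hN hw hΛ hT (-3) 1 (δ / 48) c5a (by norm_num) hn1 (by ring) hc5a hK48 hBS hcY50 (by positivity)
      (by push_cast; linarith) cSw hY5
  obtain ⟨e5, he5⟩ : ∃ c : ℝ, Λ ^ 3 * C₁ * c5a * Kx = c := ⟨_, rfl⟩
  have he50 : 0 ≤ e5 := by rw [← he5]; positivity
  have hT5 : HasMajorantHom blkY blkY ((EL₀ ∘ₗ Gw) ∘ₗ (Sw ∘ₗ ((mulOp c1 ∘ₗ (Gw - G)) ∘ₗ (G ∘ₗ (S ∘ₗ (G ∘ₗ ER₀))))))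
      (fun a b => w a ^ (-2 : ℤ) * shapeK g β e5 (δ / 96) a b) :=
    sES blkY blkS blkY hρ hβ hK hPr hw hΛ hT (-2) 3 (δ / 96) e5 (by norm_num) hn3 (by ring) he5 hK96 hC₁ hc5a0 (by positivity)
      (by push_cast; linarith) cEGw h5a
  -- T6 = ∂G′_□ · S_□ · G′ · [χ,Δ′](G′_□∂* − G′∂*)
  obtain ⟨c6a, hc6a⟩ : ∃ c : ℝ, Λ ^ 1 * B₁ * (θ₁ + θ₁) * Kx = c := ⟨_, rfl⟩
  have hc6a0 : 0 ≤ c6a := by rw [← hc6a]; positivity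
  have h6a : HasMajorantHom blkY blkS (G ∘ₗ (Kop ∘ₗ (Gw ∘ₗ ER₀) - Kop ∘ₗ (G ∘ₗ ER₀)))
      (fun a b => w a ^ (1 : ℤ) * shapeK g β c6a (δ / 6) a b) :=
    sEZ blkY blkS blkS hρ hβ hK hPr N hN hw hΛ hT 1 1 (δ / 6) c6a (by norm_num) hnm1 (by ring) hc6a hK6 hB₁ (by positivity)
      (by positivity) (by push_cast; linarith) cG cZlE
  obtain ⟨c6b, hc6b⟩ : ∃ c : ℝ, Λ ^ 1 * BS * c6a * Kx = c := ⟨_, rfl⟩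
  have hc6b0 : 0 ≤ c6b := by rw [← hc6b]; positivity
  have h6b : HasMajorantHom blkY blkS (Sw ∘ₗ (G ∘ₗ (Kop ∘ₗ (Gw ∘ₗ ER₀) - Kop ∘ₗ (G ∘ₗ ER₀))))
      (fun a b => w a ^ (-3 : ℤ) * shapeK g β c6b (δ / 12) a b) :=
    sES blkY blkS blkS hρ hβ hK hPr hw hΛ hT (-3) 1 (δ / 12) c6b (by norm_num) hn1 (by ring) hc6b hK12 hBS hc6a0 (by positivity)
      (by push_cast; linarith) cSw h6a
  obtain ⟨e6, he6⟩ : ∃ c : ℝ, Λ ^ 3 * C₁ * c6b * Kx = c := ⟨_, rfl⟩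
  have he60 : 0 ≤ e6 := by rw [← he6]; positivity
  have hT6 : HasMajorantHom blkY blkY ((EL₀ ∘ₗ Gw) ∘ₗ (Sw ∘ₗ (G ∘ₗ (Kop ∘ₗ (Gw ∘ₗ ER₀) - Kop ∘ₗ (G ∘ₗ ER₀)))))
      (fun a b => w a ^ (-2 : ℤ) * shapeK g β e6 (δ / 24) a b) :=
    sES blkY blkS blkY hρ hβ hK hPr hw hΛ hT (-2) 3 (δ / 24) e6 (by norm_num) hn3 (by ring) he6 hK24 hC₁ hc6b0 (by positivity)
      (by push_cast; linarith) cEGw h6b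
  -- T7 = ∂G′_□ · S_□ · (1 − χ)(G′∂* − G′_□∂*)
  obtain ⟨c7a, hc7a⟩ : ∃ c : ℝ, Λ ^ 1 * BS * (C₁ + C₁) * Kx = c := ⟨_, rfl⟩
  have hc7a0 : 0 ≤ c7a := by rw [← hc7a]; positivity
  have h7a : HasMajorantHom blkY blkS (Sw ∘ₗ (mulOp c1 ∘ₗ (G ∘ₗ ER₀ - Gw ∘ₗ ER₀)))
      (fun a b => w a ^ (-3 : ℤ) * shapeK g β c7a (δ / 6) a b) :=
    sEZ blkY blkS blkS hρ hβ hK hPr N hN hw hΛ hT (-3) 1 (δ / 6) c7a (by norm_num) hn1 (by ring) hc7a hK6 hBS (by positivity)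
      (by positivity) (by push_cast; linarith) cSw cY2
  obtain ⟨e7, he7⟩ : ∃ c : ℝ, Λ ^ 3 * C₁ * c7a * Kx = c := ⟨_, rfl⟩
  have he70 : 0 ≤ e7 := by rw [← he7]; positivity
  have hT7 : HasMajorantHom blkY blkY ((EL₀ ∘ₗ Gw) ∘ₗ (Sw ∘ₗ (mulOp c1 ∘ₗ (G ∘ₗ ER₀ - Gw ∘ₗ ER₀))))
      (fun a b => w a ^ (-2 : ℤ) * shapeK g β e7 (δ / 12) a b) :=
    sES blkY blkS blkY hρ hβ hK hPr hw hΛ hT (-2) 3 (δ / 12) e7 (by norm_num) hn3 (by ring) he7 hK12 hC₁ hc7a0 (by positivity)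
      (by push_cast; linarith) cEGw h7a
  -- common rate δ/192 and the sum
  have w1 := hom_weaken_shape blkY blkY hρ hβ hw he10 le_rfl (by linarith : δ / 192 ≤ δ / 24) hT1
  have w2 := hT2
  have w3 := hom_weaken_shape blkY blkY hρ hβ hw he30 le_rfl (by linarith : δ / 192 ≤ δ / 96) hT3
  have w4 := hT4
  have w5 := hom_weaken_shape blkY blkY hρ hβ hw he50 le_rfl (by linarith : δ / 192 ≤ δ / 96) hT5
  have w6 := hom_weaken_shape blkY blkY hρ hβ hw he60 le_rfl (by linarith : δ / 192 ≤ δ / 24) hT6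
  have w7 := hom_weaken_shape blkY blkY hρ hβ hw he70 le_rfl (by linarith : δ / 192 ≤ δ / 12) hT7
  have hsum := hasMajorantHom_add blkY blkY (hasMajorantHom_add blkY blkY (hasMajorantHom_add blkY blkY (hasMajorantHom_add blkY blkY
    (hasMajorantHom_add blkY blkY (hasMajorantHom_add blkY blkY w1 w2) w3) w4) w5) w6) w7
  have hCD : e1 + e2 + e3 + e4 + e5 + e6 + e7 = CDtot Λ B₁ BS C₁ θ θ₁ Kx := by
    rw [← he1, ← he2, ← he3, ← he4, ← he5, ← he6, ← he7, ← hc2c, ← hc2b, ← hc2a, ← hc3b, ← hc3a, ← hcY3, ← hc4b, ← hc4a, ← hcZ4,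
      ← hc5a, ← hcY5, ← hc6b, ← hc6a, ← hc7a, ← hcE4, ← hcZ1, ← hcSG]
    unfold CDtot; ring
  have hCD0 : 0 ≤ CDtot Λ B₁ BS C₁ θ θ₁ Kx := CDtot_nonneg hΛ hB₁ hBS hC₁ hθ hθ₁ hKx'
  have hsum' : HasMajorant blkY
      (((EL₀ ∘ₗ G) ∘ₗ ((Kop * Gw - Kop * G) ∘ₗ (S ∘ₗ (G ∘ₗ ER₀)))) +
        ((EL₀ ∘ₗ Gw) ∘ₗ (Sw ∘ₗ (Gw ∘ₗ (G ∘ₗ ((Kop * G - Kop * Gw) ∘ₗ (S ∘ₗ (G ∘ₗ ER₀))))))) +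
        ((EL₀ ∘ₗ Gw) ∘ₗ (Sw ∘ₗ (Gw ∘ₗ ((mulOp c1 ∘ₗ (Gw - G)) ∘ₗ (S ∘ₗ (G ∘ₗ ER₀)))))) +
        ((EL₀ ∘ₗ Gw) ∘ₗ (Sw ∘ₗ (G ∘ₗ ((Kop * G - Kop * Gw) ∘ₗ (G ∘ₗ (S ∘ₗ (G ∘ₗ ER₀))))))) +
        ((EL₀ ∘ₗ Gw) ∘ₗ (Sw ∘ₗ ((mulOp c1 ∘ₗ (Gw - G)) ∘ₗ (G ∘ₗ (S ∘ₗ (G ∘ₗ ER₀)))))) +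
        ((EL₀ ∘ₗ Gw) ∘ₗ (Sw ∘ₗ (G ∘ₗ (Kop ∘ₗ (Gw ∘ₗ ER₀) - Kop ∘ₗ (G ∘ₗ ER₀))))) +
        ((EL₀ ∘ₗ Gw) ∘ₗ (Sw ∘ₗ (mulOp c1 ∘ₗ (G ∘ₗ ER₀ - Gw ∘ₗ ER₀)))))
      (fun a b => w a ^ (-2 : ℤ) * shapeK g β (CDtot Λ B₁ BS C₁ θ θ₁ Kx) (δ / 192) a b) := by
    refine hasMajorant_mono blkY ((hasMajorantHom_iff blkY _ _).1 hsum) (fun a b => le_of_eq ?_)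
    rw [← hCD]; simp only [shapeK_apply]; ring
  -- the operator = the seven chains
  have hop := line3P_expand (S := S) (Sw := Sw) (ER₀ := ER₀) (h := h) hGD hDG hχGw hS1 hS2 hcL hEL
  -- the deep evaluation
  have hfin := deep_eval_shape blkY (W := fun a => w a ^ (-2 : ℤ)) (fun a => zpow_nonneg (hw a).le _) hCD0 (by positivity : (0 : ℝ) ≤ δ / 192)
    hsum' hζ1 hh1 hζdeep hhdeep
  rw [hop]
  refine hasMajorant_mono blkY hfin (fun a b => le_of_eq ?_)
  have hw2 : w a ^ (-2 : ℤ) = (w a ^ 2)⁻¹ := by rw [zpow_neg, zpow_ofNat]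
  rw [hw2, show Real.exp (-(δ / 96 * M₀)) = Real.exp (-(δ / 192 * M₀)) * Real.exp (-(δ / 192 * M₀)) by
    rw [← Real.exp_add]; congr 1; ring]
  field_simp

/-- **THE SAME WITH THE DEPTH = THE DISTANCE TO THE ZONE** (b06's `zoneDepth`): the cut-offs `ζ`, `h` live on blocks at distance `≥ M₀` from EVERY block of the
zone `N ≠ ∅` where `χ` differs from `1` — the consumer's form of *"□ and supp h_□ are M big blocks away from □̃ᶜ"*. [cite: Balaban1984PropagatorsII, (2.92) p.239 (line 3), p.238, (2.134) p.247] -/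
theorem line3P_hasMajorant_zone (blkS : Xs → g.Site) (blkY : Y → g.Site)
    (hρ : IsPseudoDist g.dist) {K : ℝ → ℝ} (hK : ∀ a, 0 < a → 0 ≤ K a)
    (hPr : Profile g.dist (fun a : g.Site => a) K) (N : Finset g.Site) (hNne : N.Nonempty)
    {w : g.Site → ℝ} (hw : ∀ a, 0 < w a) {κ Λ δ Kx : ℝ} (hΛ : 0 ≤ Λ)
    (hT : ∀ a c, Real.exp (-(κ * g.dist a c)) * w c ≤ Λ * w a) (hδ : 0 < δ) (hκδ : 6 * κ ≤ δ)
    (hKx : ∀ a, δ / 192 ≤ a → K a ≤ Kx)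
    {G D Gw S Sw : Module.End ℝ (Xs → ℝ)} {χ cL : Xs → ℝ} {EL₀ : (Xs → ℝ) →ₗ[ℝ] (Y → ℝ)} {ER₀ : (Y → ℝ) →ₗ[ℝ] (Xs → ℝ)} {ζ h : Y → ℝ}
    (hGD : G * D = 1) (hDG : D * G = 1) (hχGw : mulOp χ * D * Gw = mulOp χ)
    (hS1 : Sw * (G * G) * S = Sw) (hS2 : Gw * Sw * (Gw * Gw) * S = Gw * S)
    (hcL : ∀ x, cL x * χ x = cL x) (hEL : (mulOp ζ ∘ₗ EL₀) ∘ₗ mulOp cL = mulOp ζ ∘ₗ EL₀)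
    (hχ0 : ∀ x, 0 ≤ χ x) (hχ1 : ∀ x, χ x ≤ 1) (hχN : ∀ x, blkS x ∉ N → χ x = 1)
    (hζ1 : ∀ v, |ζ v| ≤ 1) (hh1 : ∀ v, |h v| ≤ 1) {M₀ : ℝ}
    (hζdeep : ∀ v, ζ v ≠ 0 → ∀ n ∈ N, M₀ ≤ g.dist (blkY v) n) (hhdeep : ∀ v, h v ≠ 0 → ∀ n ∈ N, M₀ ≤ g.dist (blkY v) n)
    {B₁ BS C₁ θ θ₁ : ℝ} (hB₁ : 0 ≤ B₁) (hBS : 0 ≤ BS) (hC₁ : 0 ≤ C₁) (hθ : 0 ≤ θ) (hθ₁ : 0 ≤ θ₁)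
    (mG : HasMajorant blkS G (fun a b => B₁ * w a ^ 2 * Real.exp (-(δ * g.dist a b))))
    (mGw : HasMajorant blkS Gw (fun a b => B₁ * w a ^ 2 * Real.exp (-(δ * g.dist a b))))
    (mS : HasMajorant blkS S (fun a b => BS * (w a ^ 4)⁻¹ * Real.exp (-(δ * g.dist a b))))
    (mSw : HasMajorant blkS Sw (fun a b => BS * (w a ^ 4)⁻¹ * Real.exp (-(δ * g.dist a b))))
    (mEG : HasMajorantHom blkS blkY (EL₀ ∘ₗ G) (fun a b => C₁ * w a * Real.exp (-(δ * g.dist a b))))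
    (mEGw : HasMajorantHom blkS blkY (EL₀ ∘ₗ Gw) (fun a b => C₁ * w a * Real.exp (-(δ * g.dist a b))))
    (mGE : HasMajorantHom blkY blkS (G ∘ₗ ER₀) (fun a b => C₁ * w a * Real.exp (-(δ * g.dist a b))))
    (mGwE : HasMajorantHom blkY blkS (Gw ∘ₗ ER₀) (fun a b => C₁ * w a * Real.exp (-(δ * g.dist a b))))
    (mKG : HasMajorant blkS ((mulOp χ * D - D * mulOp χ) * G) (fun a b => (if a ∈ N then θ else 0) * Real.exp (-(δ * g.dist a b))))
    (mKGw : HasMajorant blkS ((mulOp χ * D - D * mulOp χ) * Gw) (fun a b => (if a ∈ N then θ else 0) * Real.exp (-(δ * g.dist a b))))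
    (mKGE : HasMajorantHom blkY blkS ((mulOp χ * D - D * mulOp χ) ∘ₗ (G ∘ₗ ER₀))
      (fun a b => (if a ∈ N then θ₁ else 0) * (w a)⁻¹ * Real.exp (-(δ * g.dist a b))))
    (mKGwE : HasMajorantHom blkY blkS ((mulOp χ * D - D * mulOp χ) ∘ₗ (Gw ∘ₗ ER₀))
      (fun a b => (if a ∈ N then θ₁ else 0) * (w a)⁻¹ * Real.exp (-(δ * g.dist a b)))) :
    HasMajorant blkY (mulOp ζ * ((EL₀ ∘ₗ (G * S * G - Gw * Sw * Gw)) ∘ₗ ER₀) * mulOp h)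
      (fun a b => CDtot Λ B₁ BS C₁ θ θ₁ Kx * Real.exp (-(δ / 96 * M₀)) / w a ^ 2 * Real.exp (-(δ / 192 * g.dist a b))) :=
  line3P_hasMajorant blkS blkY hρ (isDepth_zoneDepth hρ N hNne) hK hPr N (fun _ ha => zoneDepth_eq_zero hρ hNne ha) hw hΛ hT hδ hκδ hKx
    hGD hDG hχGw hS1 hS2 hcL hEL hχ0 hχ1 hχN hζ1 hh1 (fun v hv => le_zoneDepth g.dist hNne (hζdeep v hv))
    (fun v hv => le_zoneDepth g.dist hNne (hhdeep v hv)) hB₁ hBS hC₁ hθ hθ₁ mG mGw mS mSw mEG mEGw mGE mGwE mKG mKGw mKGE mKGwE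

/-! ## §4  v1.1: the cut legs `ζ∂G′`, `G′∂*h` (p22's flag: the only uniform shape for a transplanted member) -/

omit [DecidableEq g.Site] in
/-- the indicator of the support of a cut-off, in front of the cut-off, is absorbed: `1_{ζ≠0}·ζ· = ζ·`. [folklore] -/
private theorem mulOp_ind_mul_mulOp (ζ : Y → ℝ) :
    (mulOp (fun v => if ζ v ≠ 0 then (1 : ℝ) else 0) * mulOp ζ : Module.End ℝ (Y → ℝ)) = mulOp ζ := by
  apply LinearMap.ext
  intro μ
  funext v
  simp only [Module.End.mul_apply, mulOp_apply]
  by_cases hv : ζ v ≠ 0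
  · rw [if_pos hv, one_mul]
  · rw [if_neg hv, not_not.1 hv, zero_mul, zero_mul]

omit [DecidableEq g.Site] in
/-- behind the cut-off: `h·1_{h≠0}· = h·`. [folklore] -/
private theorem mulOp_mul_mulOp_ind (h : Y → ℝ) :
    (mulOp h * mulOp (fun v => if h v ≠ 0 then (1 : ℝ) else 0) : Module.End ℝ (Y → ℝ)) = mulOp h := by
  apply LinearMap.ext
  intro μ
  funext v
  simp only [Module.End.mul_apply, mulOp_apply]
  by_cases hv : h v ≠ 0
  · rw [if_pos hv, one_mul]
  · rw [if_neg hv, not_not.1 hv, zero_mul, zero_mul]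

omit [DecidableEq g.Site] in
/-- an indicator is bounded by `1`. [folklore] -/
private theorem abs_ind_le_one (ζ : Y → ℝ) (v : Y) : |(fun v => if ζ v ≠ 0 then (1 : ℝ) else 0) v| ≤ 1 := by
  dsimp only
  split_ifs <;> simp

/-- **(2.92) LINE 3 WITH THE CUT LEGS** — the same conclusion as `line3P_hasMajorant`, with the six leg inputs restated for `ζ∂ := mulOp ζ ∘ EL₀` and
`∂*h := ER₀ ∘ mulOp h`: (2.67)₂ `C₁we^{−δd}` for `ζ∂G′`, `ζ∂G′_□`; (2.67)₃ `C₁we^{−δd}` for `G′∂*h`, `G′_□∂*h`; the zone-leg kernels `1_N(y)θ₁w^{−1}e^{−δd}` of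
`[χ,Δ′]G′∂*h`, `[χ,Δ′]G′_□∂*h` (for a member transplanted to a window these CUT legs are the ones with uniform constants — the cut-offs kill the bonds crossing the
window boundary). Corollary of `line3P_hasMajorant` for the legs `ζ∂`, `∂*h` and the cut-offs `1_{ζ≠0}`, `1_{h≠0}`.
[cite: Balaban1984PropagatorsII, (2.92) p.239 (line 3), (2.134) p.247, (2.67) p.234, p.238] -/
theorem line3P_hasMajorant_cut (blkS : Xs → g.Site) (blkY : Y → g.Site)
    (hρ : IsPseudoDist g.dist) {β : g.Site → ℝ} (hβ : IsDepth g.dist β) {K : ℝ → ℝ} (hK : ∀ a, 0 < a → 0 ≤ K a)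
    (hPr : Profile g.dist (fun a : g.Site => a) K) (N : Finset g.Site) (hN : ∀ a ∈ N, β a = 0)
    {w : g.Site → ℝ} (hw : ∀ a, 0 < w a) {κ Λ δ Kx : ℝ} (hΛ : 0 ≤ Λ)
    (hT : ∀ a c, Real.exp (-(κ * g.dist a c)) * w c ≤ Λ * w a) (hδ : 0 < δ) (hκδ : 6 * κ ≤ δ)
    (hKx : ∀ a, δ / 192 ≤ a → K a ≤ Kx)
    {G D Gw S Sw : Module.End ℝ (Xs → ℝ)} {χ cL : Xs → ℝ} {EL₀ : (Xs → ℝ) →ₗ[ℝ] (Y → ℝ)} {ER₀ : (Y → ℝ) →ₗ[ℝ] (Xs → ℝ)} {ζ h : Y → ℝ}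
    (hGD : G * D = 1) (hDG : D * G = 1) (hχGw : mulOp χ * D * Gw = mulOp χ)
    (hS1 : Sw * (G * G) * S = Sw) (hS2 : Gw * Sw * (Gw * Gw) * S = Gw * S)
    (hcL : ∀ x, cL x * χ x = cL x) (hEL : (mulOp ζ ∘ₗ EL₀) ∘ₗ mulOp cL = mulOp ζ ∘ₗ EL₀)
    (hχ0 : ∀ x, 0 ≤ χ x) (hχ1 : ∀ x, χ x ≤ 1) (hχN : ∀ x, blkS x ∉ N → χ x = 1) {M₀ : ℝ}
    (hζdeep : ∀ v, ζ v ≠ 0 → M₀ ≤ β (blkY v)) (hhdeep : ∀ v, h v ≠ 0 → M₀ ≤ β (blkY v))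
    {B₁ BS C₁ θ θ₁ : ℝ} (hB₁ : 0 ≤ B₁) (hBS : 0 ≤ BS) (hC₁ : 0 ≤ C₁) (hθ : 0 ≤ θ) (hθ₁ : 0 ≤ θ₁)
    (mG : HasMajorant blkS G (fun a b => B₁ * w a ^ 2 * Real.exp (-(δ * g.dist a b))))
    (mGw : HasMajorant blkS Gw (fun a b => B₁ * w a ^ 2 * Real.exp (-(δ * g.dist a b))))
    (mS : HasMajorant blkS S (fun a b => BS * (w a ^ 4)⁻¹ * Real.exp (-(δ * g.dist a b))))
    (mSw : HasMajorant blkS Sw (fun a b => BS * (w a ^ 4)⁻¹ * Real.exp (-(δ * g.dist a b))))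
    (mEG' : HasMajorantHom blkS blkY ((mulOp ζ ∘ₗ EL₀) ∘ₗ G) (fun a b => C₁ * w a * Real.exp (-(δ * g.dist a b))))
    (mEGw' : HasMajorantHom blkS blkY ((mulOp ζ ∘ₗ EL₀) ∘ₗ Gw) (fun a b => C₁ * w a * Real.exp (-(δ * g.dist a b))))
    (mGE' : HasMajorantHom blkY blkS (G ∘ₗ (ER₀ ∘ₗ mulOp h)) (fun a b => C₁ * w a * Real.exp (-(δ * g.dist a b))))
    (mGwE' : HasMajorantHom blkY blkS (Gw ∘ₗ (ER₀ ∘ₗ mulOp h)) (fun a b => C₁ * w a * Real.exp (-(δ * g.dist a b))))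
    (mKG : HasMajorant blkS ((mulOp χ * D - D * mulOp χ) * G) (fun a b => (if a ∈ N then θ else 0) * Real.exp (-(δ * g.dist a b))))
    (mKGw : HasMajorant blkS ((mulOp χ * D - D * mulOp χ) * Gw) (fun a b => (if a ∈ N then θ else 0) * Real.exp (-(δ * g.dist a b))))
    (mKGE' : HasMajorantHom blkY blkS ((mulOp χ * D - D * mulOp χ) ∘ₗ (G ∘ₗ (ER₀ ∘ₗ mulOp h)))
      (fun a b => (if a ∈ N then θ₁ else 0) * (w a)⁻¹ * Real.exp (-(δ * g.dist a b))))
    (mKGwE' : HasMajorantHom blkY blkS ((mulOp χ * D - D * mulOp χ) ∘ₗ (Gw ∘ₗ (ER₀ ∘ₗ mulOp h)))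
      (fun a b => (if a ∈ N then θ₁ else 0) * (w a)⁻¹ * Real.exp (-(δ * g.dist a b)))) :
    HasMajorant blkY (mulOp ζ * ((EL₀ ∘ₗ (G * S * G - Gw * Sw * Gw)) ∘ₗ ER₀) * mulOp h)
      (fun a b => CDtot Λ B₁ BS C₁ θ θ₁ Kx * Real.exp (-(δ / 96 * M₀)) / w a ^ 2 * Real.exp (-(δ / 192 * g.dist a b))) := by
  classical
  -- the indicator cut-offs `1_{ζ≠0}`, `1_{h≠0}` in front of / behind the cut legs
  have hEL' : ((mulOp (fun v => if ζ v ≠ 0 then (1 : ℝ) else 0) ∘ₗ (mulOp ζ ∘ₗ EL₀)) ∘ₗ mulOp cL) =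
      mulOp (fun v => if ζ v ≠ 0 then (1 : ℝ) else 0) ∘ₗ (mulOp ζ ∘ₗ EL₀) := by
    rw [LinearMap.comp_assoc, hEL]
  have key := line3P_hasMajorant blkS blkY hρ hβ hK hPr N hN hw hΛ hT hδ hκδ hKx (EL₀ := mulOp ζ ∘ₗ EL₀) (ER₀ := ER₀ ∘ₗ mulOp h)
    (ζ := fun v => if ζ v ≠ 0 then (1 : ℝ) else 0) (h := fun v => if h v ≠ 0 then (1 : ℝ) else 0)
    hGD hDG hχGw hS1 hS2 hcL hEL' hχ0 hχ1 hχN (abs_ind_le_one ζ) (abs_ind_le_one h)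
    (fun v hv => hζdeep v (fun h0 => hv (by simp [h0])))
    (fun v hv => hhdeep v (fun h0 => hv (by simp [h0])))
    hB₁ hBS hC₁ hθ hθ₁ mG mGw mS mSw mEG' mEGw' mGE' mGwE' mKG mKGw mKGE' mKGwE'
  -- fold the cut-offs back: `1_{ζ≠0}·(ζ∂ X ∂*h)·1_{h≠0} = ζ(∂ X ∂*)h`
  have e : (mulOp (fun v => if ζ v ≠ 0 then (1 : ℝ) else 0) *
        (((mulOp ζ ∘ₗ EL₀) ∘ₗ (G * S * G - Gw * Sw * Gw)) ∘ₗ (ER₀ ∘ₗ mulOp h)) *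
        mulOp (fun v => if h v ≠ 0 then (1 : ℝ) else 0) : Module.End ℝ (Y → ℝ)) =
      mulOp ζ * ((EL₀ ∘ₗ (G * S * G - Gw * Sw * Gw)) ∘ₗ ER₀) * mulOp h := by
    calc _ = (mulOp (fun v => if ζ v ≠ 0 then (1 : ℝ) else 0) * mulOp ζ) * ((EL₀ ∘ₗ (G * S * G - Gw * Sw * Gw)) ∘ₗ ER₀) *
          (mulOp h * mulOp (fun v => if h v ≠ 0 then (1 : ℝ) else 0)) := by
            simp only [Module.End.mul_eq_comp, LinearMap.comp_assoc]
      _ = _ := by rw [mulOp_ind_mul_mulOp, mulOp_mul_mulOp_ind]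
  rw [e] at key
  exact key

/-- **(2.92) LINE 3 WITH THE CUT LEGS, DEPTH = d-DISTANCE TO THE ZONE** — the corollary `line3P_hasMajorant_zone` with the six leg inputs cut (`ζ∂G′`,
`ζ∂G′_□`, `G′∂*h`, `G′_□∂*h`, `[χ,Δ′]G′∂*h`, `[χ,Δ′]G′_□∂*h`). [cite: Balaban1984PropagatorsII, (2.92) p.239 (line 3), (2.134) p.247, (2.67) p.234, p.238] -/
theorem line3P_hasMajorant_zone_cut (blkS : Xs → g.Site) (blkY : Y → g.Site)
    (hρ : IsPseudoDist g.dist) {K : ℝ → ℝ} (hK : ∀ a, 0 < a → 0 ≤ K a)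
    (hPr : Profile g.dist (fun a : g.Site => a) K) (N : Finset g.Site) (hNne : N.Nonempty)
    {w : g.Site → ℝ} (hw : ∀ a, 0 < w a) {κ Λ δ Kx : ℝ} (hΛ : 0 ≤ Λ)
    (hT : ∀ a c, Real.exp (-(κ * g.dist a c)) * w c ≤ Λ * w a) (hδ : 0 < δ) (hκδ : 6 * κ ≤ δ)
    (hKx : ∀ a, δ / 192 ≤ a → K a ≤ Kx)
    {G D Gw S Sw : Module.End ℝ (Xs → ℝ)} {χ cL : Xs → ℝ} {EL₀ : (Xs → ℝ) →ₗ[ℝ] (Y → ℝ)} {ER₀ : (Y → ℝ) →ₗ[ℝ] (Xs → ℝ)} {ζ h : Y → ℝ}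
    (hGD : G * D = 1) (hDG : D * G = 1) (hχGw : mulOp χ * D * Gw = mulOp χ)
    (hS1 : Sw * (G * G) * S = Sw) (hS2 : Gw * Sw * (Gw * Gw) * S = Gw * S)
    (hcL : ∀ x, cL x * χ x = cL x) (hEL : (mulOp ζ ∘ₗ EL₀) ∘ₗ mulOp cL = mulOp ζ ∘ₗ EL₀)
    (hχ0 : ∀ x, 0 ≤ χ x) (hχ1 : ∀ x, χ x ≤ 1) (hχN : ∀ x, blkS x ∉ N → χ x = 1) {M₀ : ℝ}
    (hζdeep : ∀ v, ζ v ≠ 0 → ∀ n ∈ N, M₀ ≤ g.dist (blkY v) n) (hhdeep : ∀ v, h v ≠ 0 → ∀ n ∈ N, M₀ ≤ g.dist (blkY v) n)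
    {B₁ BS C₁ θ θ₁ : ℝ} (hB₁ : 0 ≤ B₁) (hBS : 0 ≤ BS) (hC₁ : 0 ≤ C₁) (hθ : 0 ≤ θ) (hθ₁ : 0 ≤ θ₁)
    (mG : HasMajorant blkS G (fun a b => B₁ * w a ^ 2 * Real.exp (-(δ * g.dist a b))))
    (mGw : HasMajorant blkS Gw (fun a b => B₁ * w a ^ 2 * Real.exp (-(δ * g.dist a b))))
    (mS : HasMajorant blkS S (fun a b => BS * (w a ^ 4)⁻¹ * Real.exp (-(δ * g.dist a b))))
    (mSw : HasMajorant blkS Sw (fun a b => BS * (w a ^ 4)⁻¹ * Real.exp (-(δ * g.dist a b))))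
    (mEG' : HasMajorantHom blkS blkY ((mulOp ζ ∘ₗ EL₀) ∘ₗ G) (fun a b => C₁ * w a * Real.exp (-(δ * g.dist a b))))
    (mEGw' : HasMajorantHom blkS blkY ((mulOp ζ ∘ₗ EL₀) ∘ₗ Gw) (fun a b => C₁ * w a * Real.exp (-(δ * g.dist a b))))
    (mGE' : HasMajorantHom blkY blkS (G ∘ₗ (ER₀ ∘ₗ mulOp h)) (fun a b => C₁ * w a * Real.exp (-(δ * g.dist a b))))
    (mGwE' : HasMajorantHom blkY blkS (Gw ∘ₗ (ER₀ ∘ₗ mulOp h)) (fun a b => C₁ * w a * Real.exp (-(δ * g.dist a b))))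
    (mKG : HasMajorant blkS ((mulOp χ * D - D * mulOp χ) * G) (fun a b => (if a ∈ N then θ else 0) * Real.exp (-(δ * g.dist a b))))
    (mKGw : HasMajorant blkS ((mulOp χ * D - D * mulOp χ) * Gw) (fun a b => (if a ∈ N then θ else 0) * Real.exp (-(δ * g.dist a b))))
    (mKGE' : HasMajorantHom blkY blkS ((mulOp χ * D - D * mulOp χ) ∘ₗ (G ∘ₗ (ER₀ ∘ₗ mulOp h)))
      (fun a b => (if a ∈ N then θ₁ else 0) * (w a)⁻¹ * Real.exp (-(δ * g.dist a b))))
    (mKGwE' : HasMajorantHom blkY blkS ((mulOp χ * D - D * mulOp χ) ∘ₗ (Gw ∘ₗ (ER₀ ∘ₗ mulOp h)))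
      (fun a b => (if a ∈ N then θ₁ else 0) * (w a)⁻¹ * Real.exp (-(δ * g.dist a b)))) :
    HasMajorant blkY (mulOp ζ * ((EL₀ ∘ₗ (G * S * G - Gw * Sw * Gw)) ∘ₗ ER₀) * mulOp h)
      (fun a b => CDtot Λ B₁ BS C₁ θ θ₁ Kx * Real.exp (-(δ / 96 * M₀)) / w a ^ 2 * Real.exp (-(δ / 192 * g.dist a b))) :=
  line3P_hasMajorant_cut blkS blkY hρ (isDepth_zoneDepth hρ N hNne) hK hPr N (fun _ ha => zoneDepth_eq_zero hρ hNne ha) hw hΛ hT hδ hκδ hKx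
    hGD hDG hχGw hS1 hS2 hcL hEL hχ0 hχ1 hχN (fun v hv => le_zoneDepth g.dist hNne (hζdeep v hv))
    (fun v hv => le_zoneDepth g.dist hNne (hhdeep v hv)) hB₁ hBS hC₁ hθ hθ₁ mG mGw mS mSw mEG' mEGw' mGE' mGwE' mKG mKGw mKGE' mKGwE'

end Main

/-! ## §5  v1.2: term 6 re-associated — the column-zone kernel of `G′[χ,Δ′]` replaces the zone-leg inputs (p22's flag: no mixed kernel `∇G′∇*`) -/

/-- **THE TOTAL CONSTANT OF v1.2**: `CDtot` with the zone-leg term (`θ₁`) replaced by the term-6 constant of the re-associated chain `2Λ⁵B_SC₁²θ₂K_x³`.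
[cite: Balaban1984PropagatorsII, p.238 («an estimate has the factor e^{−δ₀M} …»), (2.92) p.239] -/
noncomputable def CDgk (Λ B₁ BS C₁ θ θ₂ Kx : ℝ) : ℝ :=
  CDtot Λ B₁ BS C₁ θ 0 Kx + 2 * Λ ^ 5 * BS * C₁ ^ 2 * θ₂ * Kx ^ 3

/-- `C_D ≥ 0` (v1.2). [cite: Balaban1984PropagatorsII, p.238] -/
theorem CDgk_nonneg {Λ B₁ BS C₁ θ θ₂ Kx : ℝ} (hΛ : 0 ≤ Λ) (hB₁ : 0 ≤ B₁) (hBS : 0 ≤ BS) (hC₁ : 0 ≤ C₁) (hθ : 0 ≤ θ) (hθ₂ : 0 ≤ θ₂)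
    (hKx : 0 ≤ Kx) : 0 ≤ CDgk Λ B₁ BS C₁ θ θ₂ Kx := by
  unfold CDgk
  exact add_nonneg (CDtot_nonneg hΛ hB₁ hBS hC₁ hθ le_rfl hKx) (by positivity)

section StepCol

variable [DecidableEq g.Site] {X Y Z : Type}

/-- **STEP `column-zone ⋆ exp → shape`**: a majorant `w^{γ₁}·1_N(c)θe^{−δ₁d(a,c)}` whose zone indicator sits on the INPUT block (the kernel of `G′[χ,Δ′]`:
the commutator acts first), followed by `w^{γ₂}expK(c₂, r)` with `r + |γ₂|κ ≤ δ₁`, has the (1.12)-SHAPE with the depth of BOTH ends: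
`w^{γ₁+γ₂}shapeK(β, Λ^{|γ₂|}θc₂K(r/3), r/3)` — the same sum as `…B6MajorantTransferSteps.step_exp_zone` (the indicator moves to the middle block).
[cite: Balaban1984PropagatorsII, p.238 («connected with a change of a domain»), (2.60)–(2.61) p.234] -/
theorem step_colzone_exp (blkX : X → g.Site) (blkY : Y → g.Site) (blkZ : Z → g.Site) (hρ : IsPseudoDist g.dist)
    {β : g.Site → ℝ} (hβ : IsDepth g.dist β) {K : ℝ → ℝ} (hPr : Profile g.dist (fun a : g.Site => a) K)
    (N : Finset g.Site) (hN : ∀ a ∈ N, β a = 0)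
    {w : g.Site → ℝ} (hw : ∀ a, 0 < w a) {κ Λ : ℝ} (hT : ∀ a c, Real.exp (-(κ * g.dist a c)) * w c ≤ Λ * w a)
    {T₁ : (Y → ℝ) →ₗ[ℝ] (Z → ℝ)} {T₂ : (X → ℝ) →ₗ[ℝ] (Y → ℝ)} {γ₁ γ₂ : ℤ} {θ δ₁ c₂ r : ℝ}
    (hθ : 0 ≤ θ) (hc₂ : 0 ≤ c₂) (hr : 0 < r) (hrδ : r + γ₂.natAbs * κ ≤ δ₁)
    (h₁ : HasMajorantHom blkY blkZ T₁ (fun a c => w a ^ γ₁ * zoneK g N θ δ₁ c a))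
    (h₂ : HasMajorantHom blkX blkY T₂ (fun c b => w c ^ γ₂ * expK g c₂ r c b)) :
    HasMajorantHom blkX blkZ (T₁ ∘ₗ T₂)
      (fun a b => w a ^ (γ₁ + γ₂) * shapeK g β (Λ ^ γ₂.natAbs * θ * c₂ * K (r / 3)) (r / 3) a b) := by
  have hc := comp_transfer blkX blkY blkZ hw hρ.symm hT (F := fun a c => zoneK g N θ δ₁ c a) h₁ h₂
    (fun a c => zoneK_nonneg N hθ δ₁ c a) (expK_nonneg hc₂ r)
  refine hasMajorantHom_mono blkX blkZ hc (fun a b => ?_)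
  have hΛ : 0 ≤ Λ ^ γ₂.natAbs := pow_nonneg (zero_le_one.trans (one_le_transfer hw hρ hT a)) _
  have hwγ : 0 ≤ w a ^ (γ₁ + γ₂) := zpow_nonneg (hw a).le _
  have h1 : ∑ c, Real.exp ((γ₂.natAbs : ℝ) * κ * g.dist a c) * zoneK g N θ δ₁ c a * expK g c₂ r c b ≤
      (expK g θ r * zoneK g N c₂ r) a b := by
    rw [Matrix.mul_apply]
    refine Finset.sum_le_sum fun u _ => ?_
    by_cases hu : u ∈ N
    · have ez : zoneK g N θ δ₁ u a = expK g θ δ₁ a u := by rw [zoneK_apply, expK_apply, if_pos hu, hρ.symm u a]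
      have ez' : expK g c₂ r u b = zoneK g N c₂ r u b := by rw [zoneK_apply, expK_apply, if_pos hu]
      rw [ez, ez']
      refine mul_le_mul_of_nonneg_right ?_ (zoneK_nonneg N hc₂ r u b)
      rw [expK_apply θ r a u]
      exact tilt_expK_le hρ hθ hrδ a u
    · have ez : zoneK g N θ δ₁ u a = 0 := by rw [zoneK_apply, if_neg hu, zero_mul]
      have ez' : zoneK g N c₂ r u b = 0 := by rw [zoneK_apply, if_neg hu, zero_mul]
      rw [ez, ez', mul_zero, zero_mul, mul_zero]
  have h2 := shape_conv_zone hρ hβ hPr N hN hr hθ hc₂ a b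
  calc Λ ^ γ₂.natAbs * w a ^ (γ₁ + γ₂) * ∑ c, Real.exp ((γ₂.natAbs : ℝ) * κ * g.dist a c) * zoneK g N θ δ₁ c a * expK g c₂ r c b
      ≤ Λ ^ γ₂.natAbs * w a ^ (γ₁ + γ₂) * (θ * c₂ * K (r / 3) * Real.exp (-(r / 3 * (g.dist a b + β a + β b)))) :=
        mul_le_mul_of_nonneg_left (h1.trans ((le_abs_self _).trans h2)) (mul_nonneg hΛ hwγ)
    _ = w a ^ (γ₁ + γ₂) * shapeK g β (Λ ^ γ₂.natAbs * θ * c₂ * K (r / 3)) (r / 3) a b := by rw [shapeK_apply]; ring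

/-- `step_colzone_exp` with named outputs and `K ≤ K_x`. [cite: Balaban1984PropagatorsII, (2.60)–(2.61) p.234, p.238] -/
private theorem sCZ (blkX : X → g.Site) (blkY : Y → g.Site) (blkZ : Z → g.Site) (hρ : IsPseudoDist g.dist)
    {β : g.Site → ℝ} (hβ : IsDepth g.dist β) {K : ℝ → ℝ} (hK : ∀ a, 0 < a → 0 ≤ K a) (hPr : Profile g.dist (fun a : g.Site => a) K)
    (N : Finset g.Site) (hN : ∀ a ∈ N, β a = 0)
    {w : g.Site → ℝ} (hw : ∀ a, 0 < w a) {κ Λ : ℝ} (hΛ : 0 ≤ Λ) (hT : ∀ a c, Real.exp (-(κ * g.dist a c)) * w c ≤ Λ * w a)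
    {T₁ : (Y → ℝ) →ₗ[ℝ] (Z → ℝ)} {T₂ : (X → ℝ) →ₗ[ℝ] (Y → ℝ)} {γ₁ γ₂ : ℤ} {θ δ₁ c₂ r Kx : ℝ} (γ : ℤ) (n : ℕ) (r' c : ℝ)
    (hγ : γ₁ + γ₂ = γ) (hn : γ₂.natAbs = n) (hr' : r / 3 = r') (hc : Λ ^ n * θ * c₂ * Kx = c) (hKr : K r' ≤ Kx)
    (hθ : 0 ≤ θ) (hc₂ : 0 ≤ c₂) (hr : 0 < r) (hrδ : r + n * κ ≤ δ₁)
    (h₁ : HasMajorantHom blkY blkZ T₁ (fun a b => w a ^ γ₁ * zoneK g N θ δ₁ b a))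
    (h₂ : HasMajorantHom blkX blkY T₂ (fun a b => w a ^ γ₂ * expK g c₂ r a b)) :
    HasMajorantHom blkX blkZ (T₁ ∘ₗ T₂) (fun a b => w a ^ γ * shapeK g β c r' a b) := by
  subst hγ hr' hn hc
  have hK2 : 0 ≤ K (r / 3) := hK _ (by positivity)
  exact hom_weaken_shape blkX blkZ hρ hβ hw (by positivity) (mul_le_mul_of_nonneg_left hKr (by positivity)) le_rfl
    (step_colzone_exp blkX blkY blkZ hρ hβ hPr N hN hw hT hθ hc₂ hr hrδ h₁ h₂)

/-- a column-zone kernel `θ·1_N(y′)·e^{−δd}` as `w^{(0:ℤ)}·zoneK(N, θ, δ)(y′, y)`. [cite: Balaban1984PropagatorsII, p.238] -/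
private theorem cvZT0 (blk : X → g.Site) (hρ : IsPseudoDist g.dist) (N : Finset g.Site) {T : Module.End ℝ (X → ℝ)} {w : g.Site → ℝ} {θ δ : ℝ}
    (h : HasMajorant blk T (fun a b => (if b ∈ N then θ else 0) * Real.exp (-(δ * g.dist a b)))) :
    HasMajorantHom blk blk T (fun a b => w a ^ (0 : ℤ) * zoneK g N θ δ b a) :=
  (hasMajorantHom_iff blk T _).2 (hasMajorant_mono blk h fun a b => le_of_eq (by rw [zoneK_apply, zpow_zero, one_mul, hρ.symm b a]))

end StepCol

section MainGk

variable [DecidableEq g.Site] {Xs Y : Type}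

set_option maxHeartbeats 1600000 in
/-- **(2.92) LINE 3, v1.2 — TERM 6 RE-ASSOCIATED, THE COLUMN-ZONE KERNEL OF `G′[χ,Δ′]` DISPLAYED** (p22 gen 20's flag, 2026-08-23T06:25Z: the zone-LEG
inputs `[χ,Δ′]G′∂*`, `[χ,Δ′]G′_□∂*` of `line3P_hasMajorant` would need the mixed kernel `∇G′∇*`, whose ℓ^∞ block sums are not level-uniform).  Since
`G′·[χ,Δ′]·(G′_□∂* − G′∂*) = (G′[χ,Δ′])·(G′_□∂* − G′∂*)`, term 6 closes with the kernel of the LEFT product `G′[χ,Δ′]` — zone on the INPUT side,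
`θ₂·1_N(y′)·e^{−δd}`, weight `w⁰` (by parts: `G′c_e∇_e = (G′∇_e)c_e(·+e) − G′(∇_ec_e)τ_e`, sizes `C₁w·s₁/(Mw) + B₁w²·s₂/(Mw²) = O(M⁻¹)`, NO second
difference of `G′`) — followed by the legs `G′_□∂*`, `G′∂*` (`C₁we^{−δd}`).  Same data and inputs as `line3P_hasMajorant` otherwise (the two zone-leg inputs
dropped, `mGK` added); CONCLUSION with `C_D = CDgk Λ B₁ B_S C₁ θ θ₂ K_x`.
[cite: Balaban1984PropagatorsII, (2.92) p.239 (line 3), p.238, (2.134) p.247, (2.67) p.235, (2.87) p.238, (2.60)–(2.61) p.234] -/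
theorem line3P_hasMajorant_gk (blkS : Xs → g.Site) (blkY : Y → g.Site)
    (hρ : IsPseudoDist g.dist) {β : g.Site → ℝ} (hβ : IsDepth g.dist β) {K : ℝ → ℝ} (hK : ∀ a, 0 < a → 0 ≤ K a)
    (hPr : Profile g.dist (fun a : g.Site => a) K) (N : Finset g.Site) (hN : ∀ a ∈ N, β a = 0)
    {w : g.Site → ℝ} (hw : ∀ a, 0 < w a) {κ Λ δ Kx : ℝ} (hΛ : 0 ≤ Λ)
    (hT : ∀ a c, Real.exp (-(κ * g.dist a c)) * w c ≤ Λ * w a) (hδ : 0 < δ) (hκδ : 6 * κ ≤ δ)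
    (hKx : ∀ a, δ / 192 ≤ a → K a ≤ Kx)
    {G D Gw S Sw : Module.End ℝ (Xs → ℝ)} {χ cL : Xs → ℝ} {EL₀ : (Xs → ℝ) →ₗ[ℝ] (Y → ℝ)} {ER₀ : (Y → ℝ) →ₗ[ℝ] (Xs → ℝ)} {ζ h : Y → ℝ}
    (hGD : G * D = 1) (hDG : D * G = 1) (hχGw : mulOp χ * D * Gw = mulOp χ)
    (hS1 : Sw * (G * G) * S = Sw) (hS2 : Gw * Sw * (Gw * Gw) * S = Gw * S)
    (hcL : ∀ x, cL x * χ x = cL x) (hEL : (mulOp ζ ∘ₗ EL₀) ∘ₗ mulOp cL = mulOp ζ ∘ₗ EL₀)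
    (hχ0 : ∀ x, 0 ≤ χ x) (hχ1 : ∀ x, χ x ≤ 1) (hχN : ∀ x, blkS x ∉ N → χ x = 1)
    (hζ1 : ∀ v, |ζ v| ≤ 1) (hh1 : ∀ v, |h v| ≤ 1) {M₀ : ℝ}
    (hζdeep : ∀ v, ζ v ≠ 0 → M₀ ≤ β (blkY v)) (hhdeep : ∀ v, h v ≠ 0 → M₀ ≤ β (blkY v))
    {B₁ BS C₁ θ θ₂ : ℝ} (hB₁ : 0 ≤ B₁) (hBS : 0 ≤ BS) (hC₁ : 0 ≤ C₁) (hθ : 0 ≤ θ) (hθ₂ : 0 ≤ θ₂)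
    (mG : HasMajorant blkS G (fun a b => B₁ * w a ^ 2 * Real.exp (-(δ * g.dist a b))))
    (mGw : HasMajorant blkS Gw (fun a b => B₁ * w a ^ 2 * Real.exp (-(δ * g.dist a b))))
    (mS : HasMajorant blkS S (fun a b => BS * (w a ^ 4)⁻¹ * Real.exp (-(δ * g.dist a b))))
    (mSw : HasMajorant blkS Sw (fun a b => BS * (w a ^ 4)⁻¹ * Real.exp (-(δ * g.dist a b))))
    (mEG : HasMajorantHom blkS blkY (EL₀ ∘ₗ G) (fun a b => C₁ * w a * Real.exp (-(δ * g.dist a b))))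
    (mEGw : HasMajorantHom blkS blkY (EL₀ ∘ₗ Gw) (fun a b => C₁ * w a * Real.exp (-(δ * g.dist a b))))
    (mGE : HasMajorantHom blkY blkS (G ∘ₗ ER₀) (fun a b => C₁ * w a * Real.exp (-(δ * g.dist a b))))
    (mGwE : HasMajorantHom blkY blkS (Gw ∘ₗ ER₀) (fun a b => C₁ * w a * Real.exp (-(δ * g.dist a b))))
    (mKG : HasMajorant blkS ((mulOp χ * D - D * mulOp χ) * G) (fun a b => (if a ∈ N then θ else 0) * Real.exp (-(δ * g.dist a b))))
    (mKGw : HasMajorant blkS ((mulOp χ * D - D * mulOp χ) * Gw) (fun a b => (if a ∈ N then θ else 0) * Real.exp (-(δ * g.dist a b))))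
    (mGK : HasMajorant blkS (G * (mulOp χ * D - D * mulOp χ)) (fun a b => (if b ∈ N then θ₂ else 0) * Real.exp (-(δ * g.dist a b)))) :
    HasMajorant blkY (mulOp ζ * ((EL₀ ∘ₗ (G * S * G - Gw * Sw * Gw)) ∘ₗ ER₀) * mulOp h)
      (fun a b => CDgk Λ B₁ BS C₁ θ θ₂ Kx * Real.exp (-(δ / 96 * M₀)) / w a ^ 2 * Real.exp (-(δ / 192 * g.dist a b))) := by
  -- the cutoff complement and the commutator
  set Kop : Module.End ℝ (Xs → ℝ) := mulOp χ * D - D * mulOp χ with hKop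
  set c1 : Xs → ℝ := fun x => 1 - χ x with hc1
  have hc1abs : ∀ x, |c1 x| ≤ 1 := fun x => by
    rw [hc1]; exact abs_le.2 ⟨by linarith [hχ1 x], by linarith [hχ0 x]⟩
  have hc1N : ∀ x, blkS x ∉ N → c1 x = 0 := fun x hx => by rw [hc1]; simp only [hχN x hx, sub_self]
  have hKx' : 0 ≤ Kx := (hK _ (by positivity)).trans (hKx (δ / 192) le_rfl)
  -- inputs in weight form
  have cG := cvW2 blkS mG
  have cGw := cvW2 blkS mGw
  have cS := cvWm4 blkS mS
  have cSw := cvWm4 blkS mSw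
  have cEG := cvW1 blkS blkY mEG
  have cEGw := cvW1 blkS blkY mEGw
  have cGE := cvW1 blkY blkS mGE
  have cGwE := cvW1 blkY blkS mGwE
  have cKG : HasMajorantHom blkS blkS (Kop * G) (fun a b => w a ^ (0 : ℤ) * zoneK g N θ δ a b) := cvZ0 blkS N mKG
  have cKGw : HasMajorantHom blkS blkS (Kop * Gw) (fun a b => w a ^ (0 : ℤ) * zoneK g N θ δ a b) := cvZ0 blkS N mKGw
  have cGK : HasMajorantHom blkS blkS (G ∘ₗ Kop) (fun a b => w a ^ (0 : ℤ) * zoneK g N θ₂ δ b a) := cvZT0 blkS hρ N mGK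
  -- derived pieces: the right leg at rate δ/2, the zone factors, the (1 − χ)-cuts
  have hδ2 : δ / 2 ≤ δ := by linarith
  have cGE2 : HasMajorantHom blkY blkS (G ∘ₗ ER₀) (fun a b => w a ^ (1 : ℤ) * expK g C₁ (δ / 2) a b) :=
    hom_weaken_exp blkY blkS hρ hw hC₁ le_rfl hδ2 cGE
  have cZl : HasMajorantHom blkS blkS (Kop * Gw - Kop * G) (fun a b => w a ^ (0 : ℤ) * zoneK g N (θ + θ) δ a b) :=
    hom_sub_zone blkS blkS N cKGw cKG
  have cZl' : HasMajorantHom blkS blkS (Kop * G - Kop * Gw) (fun a b => w a ^ (0 : ℤ) * zoneK g N (θ + θ) δ a b) :=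
    hom_sub_zone blkS blkS N cKG cKGw
  have cLd : HasMajorantHom blkY blkS (Gw ∘ₗ ER₀ - G ∘ₗ ER₀) (fun a b => w a ^ (1 : ℤ) * expK g (C₁ + C₁) (δ / 2) a b) :=
    hom_weaken_exp blkY blkS hρ hw (by positivity) le_rfl hδ2 (hom_sub_exp blkY blkS cGwE cGE)
  have cY1 : HasMajorantHom blkS blkS (mulOp c1 ∘ₗ (Gw - G)) (fun a b => w a ^ (2 : ℤ) * zoneK g N (B₁ + B₁) δ a b) :=
    hom_zoneCut_exp blkS blkS (hom_sub_exp blkS blkS cGw cG) c1 hc1abs N hc1N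
  have cY2 : HasMajorantHom blkY blkS (mulOp c1 ∘ₗ (G ∘ₗ ER₀ - Gw ∘ₗ ER₀)) (fun a b => w a ^ (1 : ℤ) * zoneK g N (C₁ + C₁) (δ / 2) a b) :=
    hom_weaken_zone blkY blkS hρ hw N (by positivity) le_rfl hδ2 (hom_zoneCut_exp blkY blkS (hom_sub_exp blkY blkS cGE cGwE) c1 hc1abs N hc1N)
  -- rate bookkeeping
  have hK4 : K (δ / 4) ≤ Kx := hKx _ (by linarith)
  have hK8 : K (δ / 8) ≤ Kx := hKx _ (by linarith)
  have hK16 : K (δ / 16) ≤ Kx := hKx _ (by linarith)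
  have hK24 : K (δ / 24) ≤ Kx := hKx _ (by linarith)
  have hK48 : K (δ / 48) ≤ Kx := hKx _ (by linarith)
  have hK96 : K (δ / 96) ≤ Kx := hKx _ (by linarith)
  have hK192 : K (δ / 192) ≤ Kx := hKx _ le_rfl
  have hK6 : K (δ / 6) ≤ Kx := hKx _ (by linarith)
  have hK12 : K (δ / 12) ≤ Kx := hKx _ (by linarith)
  have hn1 : ((1 : ℤ).natAbs) = 1 := rfl
  have hn3 : ((-3 : ℤ).natAbs) = 3 := rfl
  have hnm1 : ((-1 : ℤ).natAbs) = 1 := rfl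
  -- the common right piece `S·G′∂*` (weight −3, rate δ/4) and `G′·S·G′∂*` (weight −1, rate δ/8)
  obtain ⟨cSG, hcSG⟩ : ∃ c : ℝ, Λ ^ 1 * BS * C₁ * Kx = c := ⟨_, rfl⟩
  have hcSG0 : 0 ≤ cSG := by rw [← hcSG]; positivity
  have hP0 : HasMajorantHom blkY blkS (S ∘ₗ (G ∘ₗ ER₀)) (fun a b => w a ^ (-3 : ℤ) * expK g cSG (δ / 4) a b) :=
    sEE blkY blkS blkS hρ hK hPr hw hΛ hT (-3) 1 (δ / 4) cSG (by norm_num) hn1 (by ring) hcSG hK4 hBS hC₁ (by positivity)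
      (by push_cast; linarith) cS cGE2
  obtain ⟨cE4, hcE4⟩ : ∃ c : ℝ, Λ ^ 3 * B₁ * cSG * Kx = c := ⟨_, rfl⟩
  have hcE40 : 0 ≤ cE4 := by rw [← hcE4]; positivity
  have hE4 : HasMajorantHom blkY blkS (G ∘ₗ (S ∘ₗ (G ∘ₗ ER₀))) (fun a b => w a ^ (-1 : ℤ) * expK g cE4 (δ / 8) a b) :=
    sEE blkY blkS blkS hρ hK hPr hw hΛ hT (-1) 3 (δ / 8) cE4 (by norm_num) hn3 (by ring) hcE4 hK8 hB₁ hcSG0 (by positivity)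
      (by push_cast; linarith) cG hP0
  -- T1 = ∂G′ · [χ,Δ′](G′_□ − G′) · S · G′∂*
  obtain ⟨cZ1, hcZ1⟩ : ∃ c : ℝ, Λ ^ 3 * (θ + θ) * cSG * Kx = c := ⟨_, rfl⟩
  have hcZ10 : 0 ≤ cZ1 := by rw [← hcZ1]; positivity
  have hZ1 : HasMajorantHom blkY blkS ((Kop * Gw - Kop * G) ∘ₗ (S ∘ₗ (G ∘ₗ ER₀))) (fun a b => w a ^ (-3 : ℤ) * zoneK g N cZ1 (δ / 8) a b) :=
    sZE blkY blkS blkS hρ hK hPr N hw hΛ hT (-3) 3 (δ / 8) cZ1 (by norm_num) hn3 (by ring) hcZ1 hK8 (by positivity) hcSG0 (by positivity)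
      (by push_cast; linarith) cZl hP0
  obtain ⟨e1, he1⟩ : ∃ c : ℝ, Λ ^ 3 * C₁ * cZ1 * Kx = c := ⟨_, rfl⟩
  have he10 : 0 ≤ e1 := by rw [← he1]; positivity
  have hT1 : HasMajorantHom blkY blkY ((EL₀ ∘ₗ G) ∘ₗ ((Kop * Gw - Kop * G) ∘ₗ (S ∘ₗ (G ∘ₗ ER₀))))
      (fun a b => w a ^ (-2 : ℤ) * shapeK g β e1 (δ / 24) a b) :=
    sEZ blkY blkS blkY hρ hβ hK hPr N hN hw hΛ hT (-2) 3 (δ / 24) e1 (by norm_num) hn3 (by ring) he1 hK24 hC₁ hcZ10 (by positivity)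
      (by push_cast; linarith) cEG hZ1
  -- T2 = ∂G′_□ · S_□ · G′_□ · G′[χ,Δ′](G′ − G′_□) · S · G′∂*
  have hZ2 : HasMajorantHom blkY blkS ((Kop * G - Kop * Gw) ∘ₗ (S ∘ₗ (G ∘ₗ ER₀))) (fun a b => w a ^ (-3 : ℤ) * zoneK g N cZ1 (δ / 8) a b) :=
    sZE blkY blkS blkS hρ hK hPr N hw hΛ hT (-3) 3 (δ / 8) cZ1 (by norm_num) hn3 (by ring) hcZ1 hK8 (by positivity) hcSG0 (by positivity)
      (by push_cast; linarith) cZl' hP0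
  obtain ⟨c2a, hc2a⟩ : ∃ c : ℝ, Λ ^ 3 * B₁ * cZ1 * Kx = c := ⟨_, rfl⟩
  have hc2a0 : 0 ≤ c2a := by rw [← hc2a]; positivity
  have h2a : HasMajorantHom blkY blkS (G ∘ₗ ((Kop * G - Kop * Gw) ∘ₗ (S ∘ₗ (G ∘ₗ ER₀))))
      (fun a b => w a ^ (-1 : ℤ) * shapeK g β c2a (δ / 24) a b) :=
    sEZ blkY blkS blkS hρ hβ hK hPr N hN hw hΛ hT (-1) 3 (δ / 24) c2a (by norm_num) hn3 (by ring) hc2a hK24 hB₁ hcZ10 (by positivity)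
      (by push_cast; linarith) cG hZ2
  obtain ⟨c2b, hc2b⟩ : ∃ c : ℝ, Λ ^ 1 * B₁ * c2a * Kx = c := ⟨_, rfl⟩
  have hc2b0 : 0 ≤ c2b := by rw [← hc2b]; positivity
  have h2b : HasMajorantHom blkY blkS (Gw ∘ₗ (G ∘ₗ ((Kop * G - Kop * Gw) ∘ₗ (S ∘ₗ (G ∘ₗ ER₀)))))
      (fun a b => w a ^ (1 : ℤ) * shapeK g β c2b (δ / 48) a b) :=
    sES blkY blkS blkS hρ hβ hK hPr hw hΛ hT 1 1 (δ / 48) c2b (by norm_num) hnm1 (by ring) hc2b hK48 hB₁ hc2a0 (by positivity)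
      (by push_cast; linarith) cGw h2a
  obtain ⟨c2c, hc2c⟩ : ∃ c : ℝ, Λ ^ 1 * BS * c2b * Kx = c := ⟨_, rfl⟩
  have hc2c0 : 0 ≤ c2c := by rw [← hc2c]; positivity
  have h2c : HasMajorantHom blkY blkS (Sw ∘ₗ (Gw ∘ₗ (G ∘ₗ ((Kop * G - Kop * Gw) ∘ₗ (S ∘ₗ (G ∘ₗ ER₀))))))
      (fun a b => w a ^ (-3 : ℤ) * shapeK g β c2c (δ / 96) a b) :=
    sES blkY blkS blkS hρ hβ hK hPr hw hΛ hT (-3) 1 (δ / 96) c2c (by norm_num) hn1 (by ring) hc2c hK96 hBS hc2b0 (by positivity)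
      (by push_cast; linarith) cSw h2b
  obtain ⟨e2, he2⟩ : ∃ c : ℝ, Λ ^ 3 * C₁ * c2c * Kx = c := ⟨_, rfl⟩
  have he20 : 0 ≤ e2 := by rw [← he2]; positivity
  have hT2 : HasMajorantHom blkY blkY ((EL₀ ∘ₗ Gw) ∘ₗ (Sw ∘ₗ (Gw ∘ₗ (G ∘ₗ ((Kop * G - Kop * Gw) ∘ₗ (S ∘ₗ (G ∘ₗ ER₀)))))))
      (fun a b => w a ^ (-2 : ℤ) * shapeK g β e2 (δ / 192) a b) :=
    sES blkY blkS blkY hρ hβ hK hPr hw hΛ hT (-2) 3 (δ / 192) e2 (by norm_num) hn3 (by ring) he2 hK192 hC₁ hc2c0 (by positivity)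
      (by push_cast; linarith) cEGw h2c
  -- T3 = ∂G′_□ · S_□ · G′_□ · (1 − χ)(G′_□ − G′) · S · G′∂*
  obtain ⟨cY3, hcY3⟩ : ∃ c : ℝ, Λ ^ 3 * (B₁ + B₁) * cSG * Kx = c := ⟨_, rfl⟩
  have hcY30 : 0 ≤ cY3 := by rw [← hcY3]; positivity
  have hY3 : HasMajorantHom blkY blkS ((mulOp c1 ∘ₗ (Gw - G)) ∘ₗ (S ∘ₗ (G ∘ₗ ER₀))) (fun a b => w a ^ (-1 : ℤ) * zoneK g N cY3 (δ / 8) a b) :=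
    sZE blkY blkS blkS hρ hK hPr N hw hΛ hT (-1) 3 (δ / 8) cY3 (by norm_num) hn3 (by ring) hcY3 hK8 (by positivity) hcSG0 (by positivity)
      (by push_cast; linarith) cY1 hP0
  obtain ⟨c3a, hc3a⟩ : ∃ c : ℝ, Λ ^ 1 * B₁ * cY3 * Kx = c := ⟨_, rfl⟩
  have hc3a0 : 0 ≤ c3a := by rw [← hc3a]; positivity
  have h3a : HasMajorantHom blkY blkS (Gw ∘ₗ ((mulOp c1 ∘ₗ (Gw - G)) ∘ₗ (S ∘ₗ (G ∘ₗ ER₀))))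
      (fun a b => w a ^ (1 : ℤ) * shapeK g β c3a (δ / 24) a b) :=
    sEZ blkY blkS blkS hρ hβ hK hPr N hN hw hΛ hT 1 1 (δ / 24) c3a (by norm_num) hnm1 (by ring) hc3a hK24 hB₁ hcY30 (by positivity)
      (by push_cast; linarith) cGw hY3
  obtain ⟨c3b, hc3b⟩ : ∃ c : ℝ, Λ ^ 1 * BS * c3a * Kx = c := ⟨_, rfl⟩
  have hc3b0 : 0 ≤ c3b := by rw [← hc3b]; positivity
  have h3b : HasMajorantHom blkY blkS (Sw ∘ₗ (Gw ∘ₗ ((mulOp c1 ∘ₗ (Gw - G)) ∘ₗ (S ∘ₗ (G ∘ₗ ER₀)))))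
      (fun a b => w a ^ (-3 : ℤ) * shapeK g β c3b (δ / 48) a b) :=
    sES blkY blkS blkS hρ hβ hK hPr hw hΛ hT (-3) 1 (δ / 48) c3b (by norm_num) hn1 (by ring) hc3b hK48 hBS hc3a0 (by positivity)
      (by push_cast; linarith) cSw h3a
  obtain ⟨e3, he3⟩ : ∃ c : ℝ, Λ ^ 3 * C₁ * c3b * Kx = c := ⟨_, rfl⟩
  have he30 : 0 ≤ e3 := by rw [← he3]; positivity
  have hT3 : HasMajorantHom blkY blkY ((EL₀ ∘ₗ Gw) ∘ₗ (Sw ∘ₗ (Gw ∘ₗ ((mulOp c1 ∘ₗ (Gw - G)) ∘ₗ (S ∘ₗ (G ∘ₗ ER₀))))))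
      (fun a b => w a ^ (-2 : ℤ) * shapeK g β e3 (δ / 96) a b) :=
    sES blkY blkS blkY hρ hβ hK hPr hw hΛ hT (-2) 3 (δ / 96) e3 (by norm_num) hn3 (by ring) he3 hK96 hC₁ hc3b0 (by positivity)
      (by push_cast; linarith) cEGw h3b
  -- T4 = ∂G′_□ · S_□ · G′[χ,Δ′](G′ − G′_□) · G′ · S · G′∂*
  obtain ⟨cZ4, hcZ4⟩ : ∃ c : ℝ, Λ ^ 1 * (θ + θ) * cE4 * Kx = c := ⟨_, rfl⟩
  have hcZ40 : 0 ≤ cZ4 := by rw [← hcZ4]; positivity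
  have hZ4 : HasMajorantHom blkY blkS ((Kop * G - Kop * Gw) ∘ₗ (G ∘ₗ (S ∘ₗ (G ∘ₗ ER₀)))) (fun a b => w a ^ (-1 : ℤ) * zoneK g N cZ4 (δ / 16) a b) :=
    sZE blkY blkS blkS hρ hK hPr N hw hΛ hT (-1) 1 (δ / 16) cZ4 (by norm_num) hnm1 (by ring) hcZ4 hK16 (by positivity) hcE40 (by positivity)
      (by push_cast; linarith) cZl' hE4
  obtain ⟨c4a, hc4a⟩ : ∃ c : ℝ, Λ ^ 1 * B₁ * cZ4 * Kx = c := ⟨_, rfl⟩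
  have hc4a0 : 0 ≤ c4a := by rw [← hc4a]; positivity
  have h4a : HasMajorantHom blkY blkS (G ∘ₗ ((Kop * G - Kop * Gw) ∘ₗ (G ∘ₗ (S ∘ₗ (G ∘ₗ ER₀)))))
      (fun a b => w a ^ (1 : ℤ) * shapeK g β c4a (δ / 48) a b) :=
    sEZ blkY blkS blkS hρ hβ hK hPr N hN hw hΛ hT 1 1 (δ / 48) c4a (by norm_num) hnm1 (by ring) hc4a hK48 hB₁ hcZ40 (by positivity)
      (by push_cast; linarith) cG hZ4
  obtain ⟨c4b, hc4b⟩ : ∃ c : ℝ, Λ ^ 1 * BS * c4a * Kx = c := ⟨_, rfl⟩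
  have hc4b0 : 0 ≤ c4b := by rw [← hc4b]; positivity
  have h4b : HasMajorantHom blkY blkS (Sw ∘ₗ (G ∘ₗ ((Kop * G - Kop * Gw) ∘ₗ (G ∘ₗ (S ∘ₗ (G ∘ₗ ER₀))))))
      (fun a b => w a ^ (-3 : ℤ) * shapeK g β c4b (δ / 96) a b) :=
    sES blkY blkS blkS hρ hβ hK hPr hw hΛ hT (-3) 1 (δ / 96) c4b (by norm_num) hn1 (by ring) hc4b hK96 hBS hc4a0 (by positivity)
      (by push_cast; linarith) cSw h4a
  obtain ⟨e4, he4⟩ : ∃ c : ℝ, Λ ^ 3 * C₁ * c4b * Kx = c := ⟨_, rfl⟩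
  have he40 : 0 ≤ e4 := by rw [← he4]; positivity
  have hT4 : HasMajorantHom blkY blkY ((EL₀ ∘ₗ Gw) ∘ₗ (Sw ∘ₗ (G ∘ₗ ((Kop * G - Kop * Gw) ∘ₗ (G ∘ₗ (S ∘ₗ (G ∘ₗ ER₀)))))))
      (fun a b => w a ^ (-2 : ℤ) * shapeK g β e4 (δ / 192) a b) :=
    sES blkY blkS blkY hρ hβ hK hPr hw hΛ hT (-2) 3 (δ / 192) e4 (by norm_num) hn3 (by ring) he4 hK192 hC₁ hc4b0 (by positivity)
      (by push_cast; linarith) cEGw h4b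
  -- T5 = ∂G′_□ · S_□ · (1 − χ)(G′_□ − G′) · G′ · S · G′∂*
  obtain ⟨cY5, hcY5⟩ : ∃ c : ℝ, Λ ^ 1 * (B₁ + B₁) * cE4 * Kx = c := ⟨_, rfl⟩
  have hcY50 : 0 ≤ cY5 := by rw [← hcY5]; positivity
  have hY5 : HasMajorantHom blkY blkS ((mulOp c1 ∘ₗ (Gw - G)) ∘ₗ (G ∘ₗ (S ∘ₗ (G ∘ₗ ER₀)))) (fun a b => w a ^ (1 : ℤ) * zoneK g N cY5 (δ / 16) a b) :=
    sZE blkY blkS blkS hρ hK hPr N hw hΛ hT 1 1 (δ / 16) cY5 (by norm_num) hnm1 (by ring) hcY5 hK16 (by positivity) hcE40 (by positivity)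
      (by push_cast; linarith) cY1 hE4
  obtain ⟨c5a, hc5a⟩ : ∃ c : ℝ, Λ ^ 1 * BS * cY5 * Kx = c := ⟨_, rfl⟩
  have hc5a0 : 0 ≤ c5a := by rw [← hc5a]; positivity
  have h5a : HasMajorantHom blkY blkS (Sw ∘ₗ ((mulOp c1 ∘ₗ (Gw - G)) ∘ₗ (G ∘ₗ (S ∘ₗ (G ∘ₗ ER₀)))))
      (fun a b => w a ^ (-3 : ℤ) * shapeK g β c5a (δ / 48) a b) :=
    sEZ blkY blkS blkS hρ hβ hK hPr N hN hw hΛ hT (-3) 1 (δ / 48) c5a (by norm_num) hn1 (by ring) hc5a hK48 hBS hcY50 (by positivity)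
      (by push_cast; linarith) cSw hY5
  obtain ⟨e5, he5⟩ : ∃ c : ℝ, Λ ^ 3 * C₁ * c5a * Kx = c := ⟨_, rfl⟩
  have he50 : 0 ≤ e5 := by rw [← he5]; positivity
  have hT5 : HasMajorantHom blkY blkY ((EL₀ ∘ₗ Gw) ∘ₗ (Sw ∘ₗ ((mulOp c1 ∘ₗ (Gw - G)) ∘ₗ (G ∘ₗ (S ∘ₗ (G ∘ₗ ER₀))))))
      (fun a b => w a ^ (-2 : ℤ) * shapeK g β e5 (δ / 96) a b) :=
    sES blkY blkS blkY hρ hβ hK hPr hw hΛ hT (-2) 3 (δ / 96) e5 (by norm_num) hn3 (by ring) he5 hK96 hC₁ hc5a0 (by positivity)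
      (by push_cast; linarith) cEGw h5a
  -- T6 = ∂G′_□ · S_□ · (G′[χ,Δ′]) · (G′_□∂* − G′∂*)   (v1.2: re-associated, column-zone kernel of G′[χ,Δ′])
  obtain ⟨c6a, hc6a⟩ : ∃ c : ℝ, Λ ^ 1 * θ₂ * (C₁ + C₁) * Kx = c := ⟨_, rfl⟩
  have hc6a0 : 0 ≤ c6a := by rw [← hc6a]; positivity
  have h6a' : HasMajorantHom blkY blkS ((G ∘ₗ Kop) ∘ₗ (Gw ∘ₗ ER₀ - G ∘ₗ ER₀))
      (fun a b => w a ^ (1 : ℤ) * shapeK g β c6a (δ / 6) a b) :=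
    sCZ blkY blkS blkS hρ hβ hK hPr N hN hw hΛ hT 1 1 (δ / 6) c6a (by norm_num) hn1 (by ring) hc6a hK6 hθ₂ (by positivity)
      (by positivity) (by push_cast; linarith) cGK cLd
  have e6op : G ∘ₗ (Kop ∘ₗ (Gw ∘ₗ ER₀) - Kop ∘ₗ (G ∘ₗ ER₀)) = (G ∘ₗ Kop) ∘ₗ (Gw ∘ₗ ER₀ - G ∘ₗ ER₀) := by
    simp only [LinearMap.comp_sub, LinearMap.comp_assoc]
  have h6a : HasMajorantHom blkY blkS (G ∘ₗ (Kop ∘ₗ (Gw ∘ₗ ER₀) - Kop ∘ₗ (G ∘ₗ ER₀)))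
      (fun a b => w a ^ (1 : ℤ) * shapeK g β c6a (δ / 6) a b) := by
    rw [e6op]; exact h6a'
  obtain ⟨c6b, hc6b⟩ : ∃ c : ℝ, Λ ^ 1 * BS * c6a * Kx = c := ⟨_, rfl⟩
  have hc6b0 : 0 ≤ c6b := by rw [← hc6b]; positivity
  have h6b : HasMajorantHom blkY blkS (Sw ∘ₗ (G ∘ₗ (Kop ∘ₗ (Gw ∘ₗ ER₀) - Kop ∘ₗ (G ∘ₗ ER₀))))
      (fun a b => w a ^ (-3 : ℤ) * shapeK g β c6b (δ / 12) a b) :=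
    sES blkY blkS blkS hρ hβ hK hPr hw hΛ hT (-3) 1 (δ / 12) c6b (by norm_num) hn1 (by ring) hc6b hK12 hBS hc6a0 (by positivity)
      (by push_cast; linarith) cSw h6a
  obtain ⟨e6, he6⟩ : ∃ c : ℝ, Λ ^ 3 * C₁ * c6b * Kx = c := ⟨_, rfl⟩
  have he60 : 0 ≤ e6 := by rw [← he6]; positivity
  have hT6 : HasMajorantHom blkY blkY ((EL₀ ∘ₗ Gw) ∘ₗ (Sw ∘ₗ (G ∘ₗ (Kop ∘ₗ (Gw ∘ₗ ER₀) - Kop ∘ₗ (G ∘ₗ ER₀)))))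
      (fun a b => w a ^ (-2 : ℤ) * shapeK g β e6 (δ / 24) a b) :=
    sES blkY blkS blkY hρ hβ hK hPr hw hΛ hT (-2) 3 (δ / 24) e6 (by norm_num) hn3 (by ring) he6 hK24 hC₁ hc6b0 (by positivity)
      (by push_cast; linarith) cEGw h6b
  -- T7 = ∂G′_□ · S_□ · (1 − χ)(G′∂* − G′_□∂*)
  obtain ⟨c7a, hc7a⟩ : ∃ c : ℝ, Λ ^ 1 * BS * (C₁ + C₁) * Kx = c := ⟨_, rfl⟩
  have hc7a0 : 0 ≤ c7a := by rw [← hc7a]; positivity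
  have h7a : HasMajorantHom blkY blkS (Sw ∘ₗ (mulOp c1 ∘ₗ (G ∘ₗ ER₀ - Gw ∘ₗ ER₀)))
      (fun a b => w a ^ (-3 : ℤ) * shapeK g β c7a (δ / 6) a b) :=
    sEZ blkY blkS blkS hρ hβ hK hPr N hN hw hΛ hT (-3) 1 (δ / 6) c7a (by norm_num) hn1 (by ring) hc7a hK6 hBS (by positivity)
      (by positivity) (by push_cast; linarith) cSw cY2
  obtain ⟨e7, he7⟩ : ∃ c : ℝ, Λ ^ 3 * C₁ * c7a * Kx = c := ⟨_, rfl⟩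
  have he70 : 0 ≤ e7 := by rw [← he7]; positivity
  have hT7 : HasMajorantHom blkY blkY ((EL₀ ∘ₗ Gw) ∘ₗ (Sw ∘ₗ (mulOp c1 ∘ₗ (G ∘ₗ ER₀ - Gw ∘ₗ ER₀))))
      (fun a b => w a ^ (-2 : ℤ) * shapeK g β e7 (δ / 12) a b) :=
    sES blkY blkS blkY hρ hβ hK hPr hw hΛ hT (-2) 3 (δ / 12) e7 (by norm_num) hn3 (by ring) he7 hK12 hC₁ hc7a0 (by positivity)
      (by push_cast; linarith) cEGw h7a
  -- common rate δ/192 and the sum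
  have w1 := hom_weaken_shape blkY blkY hρ hβ hw he10 le_rfl (by linarith : δ / 192 ≤ δ / 24) hT1
  have w2 := hT2
  have w3 := hom_weaken_shape blkY blkY hρ hβ hw he30 le_rfl (by linarith : δ / 192 ≤ δ / 96) hT3
  have w4 := hT4
  have w5 := hom_weaken_shape blkY blkY hρ hβ hw he50 le_rfl (by linarith : δ / 192 ≤ δ / 96) hT5
  have w6 := hom_weaken_shape blkY blkY hρ hβ hw he60 le_rfl (by linarith : δ / 192 ≤ δ / 24) hT6
  have w7 := hom_weaken_shape blkY blkY hρ hβ hw he70 le_rfl (by linarith : δ / 192 ≤ δ / 12) hT7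
  have hsum := hasMajorantHom_add blkY blkY (hasMajorantHom_add blkY blkY (hasMajorantHom_add blkY blkY (hasMajorantHom_add blkY blkY
    (hasMajorantHom_add blkY blkY (hasMajorantHom_add blkY blkY w1 w2) w3) w4) w5) w6) w7
  have hCD : e1 + e2 + e3 + e4 + e5 + e6 + e7 = CDgk Λ B₁ BS C₁ θ θ₂ Kx := by
    rw [← he1, ← he2, ← he3, ← he4, ← he5, ← he6, ← he7, ← hc2c, ← hc2b, ← hc2a, ← hc3b, ← hc3a, ← hcY3, ← hc4b, ← hc4a, ← hcZ4,
      ← hc5a, ← hcY5, ← hc6b, ← hc6a, ← hc7a, ← hcE4, ← hcZ1, ← hcSG]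
    unfold CDgk CDtot; ring
  have hCD0 : 0 ≤ CDgk Λ B₁ BS C₁ θ θ₂ Kx := CDgk_nonneg hΛ hB₁ hBS hC₁ hθ hθ₂ hKx'
  have hsum' : HasMajorant blkY
      (((EL₀ ∘ₗ G) ∘ₗ ((Kop * Gw - Kop * G) ∘ₗ (S ∘ₗ (G ∘ₗ ER₀)))) +
        ((EL₀ ∘ₗ Gw) ∘ₗ (Sw ∘ₗ (Gw ∘ₗ (G ∘ₗ ((Kop * G - Kop * Gw) ∘ₗ (S ∘ₗ (G ∘ₗ ER₀))))))) +
        ((EL₀ ∘ₗ Gw) ∘ₗ (Sw ∘ₗ (Gw ∘ₗ ((mulOp c1 ∘ₗ (Gw - G)) ∘ₗ (S ∘ₗ (G ∘ₗ ER₀)))))) +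
        ((EL₀ ∘ₗ Gw) ∘ₗ (Sw ∘ₗ (G ∘ₗ ((Kop * G - Kop * Gw) ∘ₗ (G ∘ₗ (S ∘ₗ (G ∘ₗ ER₀))))))) +
        ((EL₀ ∘ₗ Gw) ∘ₗ (Sw ∘ₗ ((mulOp c1 ∘ₗ (Gw - G)) ∘ₗ (G ∘ₗ (S ∘ₗ (G ∘ₗ ER₀)))))) +
        ((EL₀ ∘ₗ Gw) ∘ₗ (Sw ∘ₗ (G ∘ₗ (Kop ∘ₗ (Gw ∘ₗ ER₀) - Kop ∘ₗ (G ∘ₗ ER₀))))) +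
        ((EL₀ ∘ₗ Gw) ∘ₗ (Sw ∘ₗ (mulOp c1 ∘ₗ (G ∘ₗ ER₀ - Gw ∘ₗ ER₀)))))
      (fun a b => w a ^ (-2 : ℤ) * shapeK g β (CDgk Λ B₁ BS C₁ θ θ₂ Kx) (δ / 192) a b) := by
    refine hasMajorant_mono blkY ((hasMajorantHom_iff blkY _ _).1 hsum) (fun a b => le_of_eq ?_)
    rw [← hCD]; simp only [shapeK_apply]; ring
  -- the operator = the seven chains
  have hop := line3P_expand (S := S) (Sw := Sw) (ER₀ := ER₀) (h := h) hGD hDG hχGw hS1 hS2 hcL hEL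
  -- the deep evaluation
  have hfin := deep_eval_shape blkY (W := fun a => w a ^ (-2 : ℤ)) (fun a => zpow_nonneg (hw a).le _) hCD0 (by positivity : (0 : ℝ) ≤ δ / 192)
    hsum' hζ1 hh1 hζdeep hhdeep
  rw [hop]
  refine hasMajorant_mono blkY hfin (fun a b => le_of_eq ?_)
  have hw2 : w a ^ (-2 : ℤ) = (w a ^ 2)⁻¹ := by rw [zpow_neg, zpow_ofNat]
  rw [hw2, show Real.exp (-(δ / 96 * M₀)) = Real.exp (-(δ / 192 * M₀)) * Real.exp (-(δ / 192 * M₀)) by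
    rw [← Real.exp_add]; congr 1; ring]
  field_simp

/-- **(2.92) LINE 3, v1.2, WITH THE CUT LEGS** — `line3P_hasMajorant_gk` with the four leg inputs restated for `ζ∂ := mulOp ζ ∘ EL₀` and `∂*h := ER₀ ∘ mulOp h`
((2.67)₂ for `ζ∂G′`, `ζ∂G′_□`; (2.67)₃ for `G′∂*h`, `G′_□∂*h` — for a member transplanted to a window the CUT legs are the ones with uniform constants); the
column-zone kernel `mGK` is leg-free. Corollary of `line3P_hasMajorant_gk` for the legs `ζ∂`, `∂*h` and the cut-offs `1_{ζ≠0}`, `1_{h≠0}`.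
[cite: Balaban1984PropagatorsII, (2.92) p.239 (line 3), (2.134) p.247, (2.67) p.234, p.238] -/
theorem line3P_hasMajorant_gk_cut (blkS : Xs → g.Site) (blkY : Y → g.Site)
    (hρ : IsPseudoDist g.dist) {β : g.Site → ℝ} (hβ : IsDepth g.dist β) {K : ℝ → ℝ} (hK : ∀ a, 0 < a → 0 ≤ K a)
    (hPr : Profile g.dist (fun a : g.Site => a) K) (N : Finset g.Site) (hN : ∀ a ∈ N, β a = 0)
    {w : g.Site → ℝ} (hw : ∀ a, 0 < w a) {κ Λ δ Kx : ℝ} (hΛ : 0 ≤ Λ)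
    (hT : ∀ a c, Real.exp (-(κ * g.dist a c)) * w c ≤ Λ * w a) (hδ : 0 < δ) (hκδ : 6 * κ ≤ δ)
    (hKx : ∀ a, δ / 192 ≤ a → K a ≤ Kx)
    {G D Gw S Sw : Module.End ℝ (Xs → ℝ)} {χ cL : Xs → ℝ} {EL₀ : (Xs → ℝ) →ₗ[ℝ] (Y → ℝ)} {ER₀ : (Y → ℝ) →ₗ[ℝ] (Xs → ℝ)} {ζ h : Y → ℝ}
    (hGD : G * D = 1) (hDG : D * G = 1) (hχGw : mulOp χ * D * Gw = mulOp χ)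
    (hS1 : Sw * (G * G) * S = Sw) (hS2 : Gw * Sw * (Gw * Gw) * S = Gw * S)
    (hcL : ∀ x, cL x * χ x = cL x) (hEL : (mulOp ζ ∘ₗ EL₀) ∘ₗ mulOp cL = mulOp ζ ∘ₗ EL₀)
    (hχ0 : ∀ x, 0 ≤ χ x) (hχ1 : ∀ x, χ x ≤ 1) (hχN : ∀ x, blkS x ∉ N → χ x = 1) {M₀ : ℝ}
    (hζdeep : ∀ v, ζ v ≠ 0 → M₀ ≤ β (blkY v)) (hhdeep : ∀ v, h v ≠ 0 → M₀ ≤ β (blkY v))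
    {B₁ BS C₁ θ θ₂ : ℝ} (hB₁ : 0 ≤ B₁) (hBS : 0 ≤ BS) (hC₁ : 0 ≤ C₁) (hθ : 0 ≤ θ) (hθ₂ : 0 ≤ θ₂)
    (mG : HasMajorant blkS G (fun a b => B₁ * w a ^ 2 * Real.exp (-(δ * g.dist a b))))
    (mGw : HasMajorant blkS Gw (fun a b => B₁ * w a ^ 2 * Real.exp (-(δ * g.dist a b))))
    (mS : HasMajorant blkS S (fun a b => BS * (w a ^ 4)⁻¹ * Real.exp (-(δ * g.dist a b))))
    (mSw : HasMajorant blkS Sw (fun a b => BS * (w a ^ 4)⁻¹ * Real.exp (-(δ * g.dist a b))))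
    (mEG' : HasMajorantHom blkS blkY ((mulOp ζ ∘ₗ EL₀) ∘ₗ G) (fun a b => C₁ * w a * Real.exp (-(δ * g.dist a b))))
    (mEGw' : HasMajorantHom blkS blkY ((mulOp ζ ∘ₗ EL₀) ∘ₗ Gw) (fun a b => C₁ * w a * Real.exp (-(δ * g.dist a b))))
    (mGE' : HasMajorantHom blkY blkS (G ∘ₗ (ER₀ ∘ₗ mulOp h)) (fun a b => C₁ * w a * Real.exp (-(δ * g.dist a b))))
    (mGwE' : HasMajorantHom blkY blkS (Gw ∘ₗ (ER₀ ∘ₗ mulOp h)) (fun a b => C₁ * w a * Real.exp (-(δ * g.dist a b))))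
    (mKG : HasMajorant blkS ((mulOp χ * D - D * mulOp χ) * G) (fun a b => (if a ∈ N then θ else 0) * Real.exp (-(δ * g.dist a b))))
    (mKGw : HasMajorant blkS ((mulOp χ * D - D * mulOp χ) * Gw) (fun a b => (if a ∈ N then θ else 0) * Real.exp (-(δ * g.dist a b))))
    (mGK : HasMajorant blkS (G * (mulOp χ * D - D * mulOp χ)) (fun a b => (if b ∈ N then θ₂ else 0) * Real.exp (-(δ * g.dist a b)))) :
    HasMajorant blkY (mulOp ζ * ((EL₀ ∘ₗ (G * S * G - Gw * Sw * Gw)) ∘ₗ ER₀) * mulOp h)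
      (fun a b => CDgk Λ B₁ BS C₁ θ θ₂ Kx * Real.exp (-(δ / 96 * M₀)) / w a ^ 2 * Real.exp (-(δ / 192 * g.dist a b))) := by
  classical
  -- the indicator cut-offs `1_{ζ≠0}`, `1_{h≠0}` in front of / behind the cut legs
  have hEL' : ((mulOp (fun v => if ζ v ≠ 0 then (1 : ℝ) else 0) ∘ₗ (mulOp ζ ∘ₗ EL₀)) ∘ₗ mulOp cL) =
      mulOp (fun v => if ζ v ≠ 0 then (1 : ℝ) else 0) ∘ₗ (mulOp ζ ∘ₗ EL₀) := by
    rw [LinearMap.comp_assoc, hEL]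
  have key := line3P_hasMajorant_gk blkS blkY hρ hβ hK hPr N hN hw hΛ hT hδ hκδ hKx (EL₀ := mulOp ζ ∘ₗ EL₀) (ER₀ := ER₀ ∘ₗ mulOp h)
    (ζ := fun v => if ζ v ≠ 0 then (1 : ℝ) else 0) (h := fun v => if h v ≠ 0 then (1 : ℝ) else 0)
    hGD hDG hχGw hS1 hS2 hcL hEL' hχ0 hχ1 hχN (abs_ind_le_one ζ) (abs_ind_le_one h)
    (fun v hv => hζdeep v (fun h0 => hv (by simp [h0])))
    (fun v hv => hhdeep v (fun h0 => hv (by simp [h0])))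
    hB₁ hBS hC₁ hθ hθ₂ mG mGw mS mSw mEG' mEGw' mGE' mGwE' mKG mKGw mGK
  -- fold the cut-offs back: `1_{ζ≠0}·(ζ∂ X ∂*h)·1_{h≠0} = ζ(∂ X ∂*)h`
  have e : (mulOp (fun v => if ζ v ≠ 0 then (1 : ℝ) else 0) *
        (((mulOp ζ ∘ₗ EL₀) ∘ₗ (G * S * G - Gw * Sw * Gw)) ∘ₗ (ER₀ ∘ₗ mulOp h)) *
        mulOp (fun v => if h v ≠ 0 then (1 : ℝ) else 0) : Module.End ℝ (Y → ℝ)) =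
      mulOp ζ * ((EL₀ ∘ₗ (G * S * G - Gw * Sw * Gw)) ∘ₗ ER₀) * mulOp h := by
    calc _ = (mulOp (fun v => if ζ v ≠ 0 then (1 : ℝ) else 0) * mulOp ζ) * ((EL₀ ∘ₗ (G * S * G - Gw * Sw * Gw)) ∘ₗ ER₀) *
          (mulOp h * mulOp (fun v => if h v ≠ 0 then (1 : ℝ) else 0)) := by
            simp only [Module.End.mul_eq_comp, LinearMap.comp_assoc]
      _ = _ := by rw [mulOp_ind_mul_mulOp, mulOp_mul_mulOp_ind]
  rw [e] at key
  exact key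

/-- **(2.92) LINE 3, v1.2, CUT LEGS, DEPTH = d-DISTANCE TO THE ZONE** — the consumer's form: zone `N ≠ ∅`, cut-offs at d-distance `≥ M₀` from every block
of `N`, the four cut legs, the row-zone kernels of `[χ,Δ′]G′`, `[χ,Δ′]G′_□` and the column-zone kernel of `G′[χ,Δ′]`. [cite: Balaban1984PropagatorsII, (2.92) p.239 (line 3), (2.134) p.247, (2.67) p.234, p.238] -/
theorem line3P_hasMajorant_gk_zone_cut (blkS : Xs → g.Site) (blkY : Y → g.Site)
    (hρ : IsPseudoDist g.dist) {K : ℝ → ℝ} (hK : ∀ a, 0 < a → 0 ≤ K a)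
    (hPr : Profile g.dist (fun a : g.Site => a) K) (N : Finset g.Site) (hNne : N.Nonempty)
    {w : g.Site → ℝ} (hw : ∀ a, 0 < w a) {κ Λ δ Kx : ℝ} (hΛ : 0 ≤ Λ)
    (hT : ∀ a c, Real.exp (-(κ * g.dist a c)) * w c ≤ Λ * w a) (hδ : 0 < δ) (hκδ : 6 * κ ≤ δ)
    (hKx : ∀ a, δ / 192 ≤ a → K a ≤ Kx)
    {G D Gw S Sw : Module.End ℝ (Xs → ℝ)} {χ cL : Xs → ℝ} {EL₀ : (Xs → ℝ) →ₗ[ℝ] (Y → ℝ)} {ER₀ : (Y → ℝ) →ₗ[ℝ] (Xs → ℝ)} {ζ h : Y → ℝ}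
    (hGD : G * D = 1) (hDG : D * G = 1) (hχGw : mulOp χ * D * Gw = mulOp χ)
    (hS1 : Sw * (G * G) * S = Sw) (hS2 : Gw * Sw * (Gw * Gw) * S = Gw * S)
    (hcL : ∀ x, cL x * χ x = cL x) (hEL : (mulOp ζ ∘ₗ EL₀) ∘ₗ mulOp cL = mulOp ζ ∘ₗ EL₀)
    (hχ0 : ∀ x, 0 ≤ χ x) (hχ1 : ∀ x, χ x ≤ 1) (hχN : ∀ x, blkS x ∉ N → χ x = 1) {M₀ : ℝ}
    (hζdeep : ∀ v, ζ v ≠ 0 → ∀ n ∈ N, M₀ ≤ g.dist (blkY v) n) (hhdeep : ∀ v, h v ≠ 0 → ∀ n ∈ N, M₀ ≤ g.dist (blkY v) n)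
    {B₁ BS C₁ θ θ₂ : ℝ} (hB₁ : 0 ≤ B₁) (hBS : 0 ≤ BS) (hC₁ : 0 ≤ C₁) (hθ : 0 ≤ θ) (hθ₂ : 0 ≤ θ₂)
    (mG : HasMajorant blkS G (fun a b => B₁ * w a ^ 2 * Real.exp (-(δ * g.dist a b))))
    (mGw : HasMajorant blkS Gw (fun a b => B₁ * w a ^ 2 * Real.exp (-(δ * g.dist a b))))
    (mS : HasMajorant blkS S (fun a b => BS * (w a ^ 4)⁻¹ * Real.exp (-(δ * g.dist a b))))
    (mSw : HasMajorant blkS Sw (fun a b => BS * (w a ^ 4)⁻¹ * Real.exp (-(δ * g.dist a b))))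
    (mEG' : HasMajorantHom blkS blkY ((mulOp ζ ∘ₗ EL₀) ∘ₗ G) (fun a b => C₁ * w a * Real.exp (-(δ * g.dist a b))))
    (mEGw' : HasMajorantHom blkS blkY ((mulOp ζ ∘ₗ EL₀) ∘ₗ Gw) (fun a b => C₁ * w a * Real.exp (-(δ * g.dist a b))))
    (mGE' : HasMajorantHom blkY blkS (G ∘ₗ (ER₀ ∘ₗ mulOp h)) (fun a b => C₁ * w a * Real.exp (-(δ * g.dist a b))))
    (mGwE' : HasMajorantHom blkY blkS (Gw ∘ₗ (ER₀ ∘ₗ mulOp h)) (fun a b => C₁ * w a * Real.exp (-(δ * g.dist a b))))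
    (mKG : HasMajorant blkS ((mulOp χ * D - D * mulOp χ) * G) (fun a b => (if a ∈ N then θ else 0) * Real.exp (-(δ * g.dist a b))))
    (mKGw : HasMajorant blkS ((mulOp χ * D - D * mulOp χ) * Gw) (fun a b => (if a ∈ N then θ else 0) * Real.exp (-(δ * g.dist a b))))
    (mGK : HasMajorant blkS (G * (mulOp χ * D - D * mulOp χ)) (fun a b => (if b ∈ N then θ₂ else 0) * Real.exp (-(δ * g.dist a b)))) :
    HasMajorant blkY (mulOp ζ * ((EL₀ ∘ₗ (G * S * G - Gw * Sw * Gw)) ∘ₗ ER₀) * mulOp h)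
      (fun a b => CDgk Λ B₁ BS C₁ θ θ₂ Kx * Real.exp (-(δ / 96 * M₀)) / w a ^ 2 * Real.exp (-(δ / 192 * g.dist a b))) :=
  line3P_hasMajorant_gk_cut blkS blkY hρ (isDepth_zoneDepth hρ N hNne) hK hPr N (fun _ ha => zoneDepth_eq_zero hρ hNne ha) hw hΛ hT hδ hκδ hKx
    hGD hDG hχGw hS1 hS2 hcL hEL hχ0 hχ1 hχN (fun v hv => le_zoneDepth g.dist hNne (hζdeep v hv))
    (fun v hv => le_zoneDepth g.dist hNne (hhdeep v hv)) hB₁ hBS hC₁ hθ hθ₂ mG mGw mS mSw mEG' mEGw' mGE' mGwE' mKG mKGw mGK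

end MainGk

end Literature.MathematicalPhysics.QuantumFieldTheory.Balaban1983to89.B6DomainChangeP2134Sizes
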